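import Literature.NumberTheory.Automorphic.StandardLTheoryGL2OfArchTestVectorAndEulerFactorisationIntegrable
import Literature.NumberTheory.Automorphic.HeckeIntegralPureTensorAbsConv
import Literature.NumberTheory.Automorphic.HeckeIntegralPureTensorDualEuler
import Literature.NumberTheory.Automorphic.HeckeJPSSIntegralUnfoldedDualGL2
import Literature.NumberTheory.Automorphic.UnramifiedLocalHeckeIntegralAbsGL2
import Literature.NumberTheory.Automorphic.FinWhittakerProductFormula
import Literature.NumberTheory.Automorphic.PureTensorCuspForm
import Literature.NumberTheory.Automorphic.SatakeParameterRankTwoBound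
import Literature.NumberTheory.Automorphic.SatakeParameterGenericBoundFlathProofs
import Literature.NumberTheory.Automorphic.GL2LocalFunctionalEquation
import Literature.NumberTheory.Automorphic.GL2LFactorRamifiedTwistOfSpherical
import Literature.NumberTheory.Automorphic.RankinSelbergLocalTwistProofs
import Literature.NumberTheory.Automorphic.MixedSpaceUnitsHaar
import Literature.NumberTheory.Automorphic.AutomorphicLFunctionFlathProofs
import Literature.NumberTheory.Automorphic.GlobalAdditiveCharacterProofs
import Literature.NumberTheory.Automorphic.ShintaniWhittakerFormula
import Literature.NumberTheory.EllipticCurves.EisensteinNewformLevelRaisingInertiaNewvectorProofs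
import HarnessLib

/-!
# The Euler factorisation with functional equation of the global Hecke integral of a pure tensor
# cusp form of `GL₂` — hypothesis `(E′)` of the standard `L`-theory, proved
# (Jacquet–Langlands (1970), (11.1.2) p. 171, p. 172, Lemma 11.1.3)

Topic `NumberTheory/Automorphic`; namespace `Literature.NumberTheory.Automorphic`. Theorems only (no
definition, no named fact, no instance).

The file `StandardLTheoryGL2OfArchTestVectorAndEulerFactorisationIntegrable` reduces the named fact
`JacquetLanglands1970_standardLTheoryGL2` (Jacquet–Langlands (1970), Thm. 11.1 with Cor. 11.2 for the
cuspidal automorphic representations of `GL₂` over a number field) — and with it Gelbart's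
`frobSatakeCompatibleAt_of_isPiOfArtinRep_of_isUnramifiedAt` — to two displayed inputs: the archimedean
test vector `(A∞)` (Thm. 5.15 / Thm. 6.4) and the Euler factorisation with functional equation of the
global Hecke integral of pure tensors `(E′)` ((11.1.2), p. 171; p. 172; Lemma 11.1.3). This file PROVES
`(E′)` (`heckeEulerFactorisationGL2`, stated VERBATIM as the hypothesis `hE` of
`integralRepresentation_clean_of_archHeckeTestVector_of_heckeEulerFactorisation'`) from the tree's
theorems, following Jacquet–Langlands' proof of Thm. 11.1 (pp. 171–173):

* the cuspidal `Π ≤ L²_cusp` decomposes as `Π ≅ τ ⊗ π_f` (`exists_archComponent_decomposition`) and the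
  global `ψ`-Whittaker functional factors as `Λ = ℓ_∞ ⊗ Λ₀` (`exists_finWhittaker_transferMap_eq_smul`)
  with `Λ₀ = C · ⊗'_v λ_v` along Flath's factorisation `π_f ≅ ⊗'_v ρ_v` (`exists_finWhittaker_prod_formula`);
* for a pure tensor `φ = e₀ ⊗ (⊗_{v ∈ S} t_v) ⊗ (⊗_{v ∉ S} x₀_v)` (`x₀_v` the spherical vectors), the
  function of `φ` is a cusp form (`isCuspFormGL_invQuot_contRep_pureTensor`), its global Hecke integral
  `Z(s) = ∫_{k^×\𝕀} φ(diag(a,1)) |a|^{s-1/2}` is entire with `Z(s) = Z̃(1-s)` for the `ι̂`-substitute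
  (`differentiable_jpssIntegral`, `jpssIntegral_comp_glTransposeInvQuot` — Lemma 11.1.3), and unfolds to
  `∫_𝕀 W_φ(diag(a,1)) |a|^{s-1/2}` (`exists_jpssIntegral_two_one_and_dual_eq_mul_integral_idele`, p. 171);
* `W_φ = W_∞ · ∏_v W_v` on the boxes of `𝕀_K` and the unfolded integral is the Euler product
  `Ψ_∞(s) ∏_{v ∈ S} Ψ_v(s) L^S(s, π)` ((11.1.2); `integral_heckeIntegrand_pureTensor_eq_mul_tprod` and its dual),
  absolutely convergent for `re s` large (p. 172; `integrable_heckeIntegrand_pureTensor`), the good local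
  factors being `L(s, π_v)` (Prop. 3.5; `integrable_and_integral_whittakerModel_diagGL2_mul_cpow` with the
  Hecke–Satake eigenvalues transported to the local components,
  `heckeOperator_heckeDiag_apply_eq_smul_of_hasSatakeParameterAt`).

Main results:

* `heckeEulerFactorisationGL2` — `(E′)`;
* `JacquetLanglands1970_standardLTheoryGL2_of_archHeckeTestVector`,
  `frobSatakeCompatibleAt_of_isPiOfArtinRep_of_isUnramifiedAt_of_archHeckeTestVector` — the standard
  `L`-theory of `GL₂` and Gelbart's Prop. 4.1 (σ-unramified places) from the archimedean test vector
  `(A∞)` ALONE (Jacquet–Langlands (1970), Thm. 5.15 (ii)(iii) / Thm. 6.4, as used on p. 173);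
* `…_of_archHeckeTestVectorCuspidal` — the same with the test vector required only for the archimedean
  components of the CUSPIDAL representations (`∃ T ∈ archIntertwiners hcpt τ Π, T ≠ 0`);
* `…_of_archHeckeTestVectorMin` — the same from the MINIMAL archimedean input: one `K_∞`-finite Gårding
  vector whose two archimedean Hecke integrals converge absolutely on a right half-plane and have there
  entire reciprocals with zeros on finitely many horizontal lines (`integralRepresentation_of_reciprocalEntire`).

## References

* H. Jacquet, R. P. Langlands, *Automorphic Forms on GL(2)*, LNM 114 (1970): (11.1.2) (p. 171), p. 172,
  Lemma 11.1.3, proof of Thm. 11.1 (pp. 171–173), Prop. 3.5. [JacquetLanglands1970]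
* J. W. Cogdell, *Lectures on L-functions, converse theorems, and functoriality for GL_n* (2004), §1.2
  (Cor. 1.4), §2.2–2.3 (Thm. 2.1, Thm. 2.2), Thm. 3.3. [CogdellAnalyticTheory2004]
* S. Gelbart, *Three lectures on the modularity of `ρ̄_{E,3}` and the Langlands reciprocity
  conjecture* (1997), Lecture II, Prop. 4.1. [Gelbart1997]
-/

noncomputable section

open MeasureTheory Measure NumberField NumberField.mixedEmbedding IsDedekindDomain Set Filter Topology
  Polynomial
open Literature.NumberTheory.GaloisRepresentations (ideleGroup unitIdeles localUnits)
open Literature.NumberTheory.GaloisRepresentations.IsNonarchimedeanLocalField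
open scoped MatrixGroups InnerProductSpace Classical NNReal ENNReal

namespace Literature.NumberTheory.Automorphic

/-! ### 1. Local inputs at the good places -/

section Local

variable {K : Type} [Field K] [NumberField K]
  {μ : Measure (AdelicGroupData.gl 2 K).automorphicQuotient}
  [(AdelicGroupData.gl 2 K).IsAutomorphicMeasure μ]

/-- **`|e₂(α_v)| = 1` for the Hecke–Satake parameter of a cuspidal `Π ≤ L²(GL₂)` at a good place**: the
top Hecke operator `T₂ = R(ι_v(ϖ · 1))` acts on the spherical vectors through the unitary right regular
representation (Jacquet–Shalika (1981), (5.1.3) for `GL₂`; the first step of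
`norm_satakeParameter_le_sqrt_two`). [cite: JacquetShalikaAJM1981, (5.1.3) p. 554] -/
theorem norm_esymm_two_eq_one_of_isSatakeFamilyOf (P : CuspidalAutomorphicRepGL 2 K μ)
    {S : Set (HeightOneSpectrum (𝓞 K))} {α : SatakeFamily K} (hα : IsSatakeFamilyOf P S α)
    {v : HeightOneSpectrum (𝓞 K)} (hv : v ∉ S) : ‖(α v).esymm 2‖ = 1 := by
  classical
  obtain ⟨𝔫, h𝔫, hv𝔫, ϖ, hsat⟩ := hα v hv
  have hsat' := hsat
  obtain ⟨hϖv, hcardα, f, hfK, hf0, -⟩ := hsat'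
  set ρv : Representation ℂ (GL (Fin 2) (v.adicCompletion K)) ((AdelicGroupData.gl 2 K).L2 μ) :=
    rightRegularLocal μ v with hρv
  set z : GL (Fin 2) (v.adicCompletion K) := heckeDiag 2 ϖ 2 with hz
  set x : (AdelicGroupData.gl 2 K).L2 μ := ((f : P.1.toSubmodule) : (AdelicGroupData.gl 2 K).L2 μ)
    with hx
  -- `x` is a non-zero spherical vector at `v`
  have hxsph : x ∈ sphericalVectorsAt μ P v := by
    refine mem_sphericalVectorsAt_iff.2 ⟨f.2, fun k hk => ?_⟩
    have hkK : GLn.ofLocal 2 K v k ∈ principalCongruenceLevel 2 K 𝔫 := by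
      refine isMaximalAt_principalCongruenceLevel 2 K v h𝔫 hv𝔫 ⟨k, ?_, rfl⟩
      rw [← glInt_adicCompletion_eq]
      exact hk
    exact congrArg Subtype.val ((P.1.mem_fixedVectors _ f).1 hfK _ hkK)
  have hx0 : x ≠ 0 := fun h => hf0 (Subtype.ext h)
  have hxK : x ∈ ρv.fixedPoints (glInt 2 (v.adicCompletion K)) := by
    rw [Representation.mem_fixedPoints]
    intro k hk
    exact (mem_sphericalVectorsAt_iff.1 hxsph).2 k hk
  have hT2 : heckeOperator ρv (glInt 2 (v.adicCompletion K)) z x = (α v).esymm 2 • x := by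
    have h := heckeOperator_rightRegularLocal_heckeDiag_eq_smul h𝔫 hv𝔫 hsat hxsph (i := 2) le_rfl
    simpa only [show 2 * (2 - 2) = 0 from rfl, pow_zero, one_mul] using h
  -- `T₂ = ρ_v(t₂)` on fixed vectors, an isometry
  have hρz : ρv z x = (α v).esymm 2 • x := by
    rw [← hT2]
    exact (heckeOperator_apply_of_forall_commute ρv (glInt 2 (v.adicCompletion K))
      (fun y => mul_heckeDiag_self_comm ϖ y) hxK).symm
  have hxn : ‖x‖ ≠ 0 := norm_ne_zero_iff.2 hx0
  have h := AdelicGroupData.norm_rightRegular_apply (AdelicGroupData.gl 2 K) μ (GLn.ofLocal 2 K v z) x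
  have h' : ‖ρv z x‖ = ‖x‖ := h
  rw [hρz, _root_.norm_smul] at h'
  exact mul_right_cancel₀ hxn (h'.trans (one_mul _).symm)

/-- **The Hecke–Satake eigenvalue equations on the local component** (Flath (1979), Thm. 3 / Bump
(1997), Thm. 3.3.3: `Π^{K(𝔫)} ≅ Π_v^{GL₂(𝒪_v)} ⊗ …`, the local Hecke operators acting by the global
eigenvalues): for a Satake family `α` of `Π` off `S`, `v ∉ S`, an irreducible local component `ρ` of
`Π` at `v` in the `L²` sense and ANY `GL₂(𝒪_v)`-fixed `x ∈ V_ρ`, the operators `T_r` (`1 ≤ r ≤ 2`,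
defined by any uniformizer `ϖ'`) act on `x` by `q_v^{r(2-r)/2} e_r(α v)`
(`heckeOperator_heckeDiag_apply_eq_smul_of_hasSatakeParameterAt`, the Satake datum transported to
`ϖ'` as in `Flath1979_isSatakeParameter_of_hasLocalComponentAt_holds`). [cite: Flath1979, Thm. 3]
[cite: Bump1997, Thm. 3.3.3 p. 296] -/
theorem heckeT_eq_smul_of_isSatakeFamilyOf_of_hasLocalComponentAt (P : CuspidalAutomorphicRepGL 2 K μ)
    {S : Set (HeightOneSpectrum (𝓞 K))} {α : SatakeFamily K} (hα : IsSatakeFamilyOf P S α)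
    {v : HeightOneSpectrum (𝓞 K)} (hv : v ∉ S)
    {V : Type*} [AddCommGroup V] [Module ℂ V] {ρ : Representation ℂ (GL (Fin 2) (v.adicCompletion K)) V}
    (hρ : ρ.IsIrreducible) (hloc : HasLocalComponentAt P.1 v ρ)
    {x : V} (hx : x ∈ ρ.fixedPoints (glInt 2 (v.adicCompletion K)))
    {ϖ' : (v.adicCompletion K)ˣ}
    (hϖ' : (ValuativeRel.valuation (v.adicCompletion K)).IsUniformizer (ϖ' : v.adicCompletion K)) :
    ∀ r, 1 ≤ r → r ≤ 2 → heckeT ρ ϖ' r x =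
      ((((Real.sqrt (residueFieldCard (v.adicCompletion K))) ^ (r * (2 - r)) : ℝ) : ℂ) *
        (α v).esymm r) • x := by
  intro r _ hr
  obtain ⟨𝔫, h𝔫, hv𝔫, ϖ, hsat⟩ := hα v hv
  obtain ⟨f, hf0, hf⟩ := hloc
  -- the uniformizer `ϖ'` of the local field has `|ϖ'|_v = exp (-1) = |ϖ|_v`
  have hval : ValuativeRel.valuation (v.adicCompletion K) ((ϖ : (v.adicCompletion K)ˣ) : v.adicCompletion K) =
      ValuativeRel.valuation (v.adicCompletion K) ((ϖ' : (v.adicCompletion K)ˣ) : v.adicCompletion K) :=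
    (isUniformizingElement_of_valued_eq K v hsat.1).valuation_eq
      (isUniformizingElement_of_isUniformizer hϖ')
  have hϖ'v : Valued.v ((ϖ' : (v.adicCompletion K)ˣ) : v.adicCompletion K) =
      WithZero.exp (-1 : ℤ) := by
    rw [← hsat.1]
    exact ((ValuativeRel.isEquiv (ValuativeRel.valuation (v.adicCompletion K))
      (Valued.v : Valuation (v.adicCompletion K) _)).eq_iff.1 hval).symm
  have hsat' : HasSatakeParameterAt P.1 (principalCongruenceLevel 2 K 𝔫) v ϖ' (α v) :=
    hsat.of_valuation_eq (isMaximalAt_principalCongruenceLevel 2 K v h𝔫 hv𝔫) hϖ'v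
  rw [heckeT_def, heckeOperator_heckeDiag_apply_eq_smul_of_hasSatakeParameterAt h𝔫 hv𝔫 hsat' hρ
    hf0 hf hx hr, residueFieldCard_adicCompletion_eq K v, Complex.ofReal_pow]

/-- For the Satake parameter `α_v = {x₀, x₁}` of a cuspidal `Π ≤ L²(GL₂)` at a good place, an enumeration
with `x₀ x₁ = e₂(α_v)`, `|x₀ x₁| = 1`, `xᵢ ≠ 0`, `|xᵢ| ≤ q_v^{1/2}` and `|xᵢ⁻¹| ≤ q_v^{1/2}`
(`norm_esymm_two_eq_one_of_isSatakeFamilyOf`, `norm_satakeParameter_le_sqrt_two`). [folklore] -/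
theorem exists_enum_satakeParameter_two (P : CuspidalAutomorphicRepGL 2 K μ)
    {S : Set (HeightOneSpectrum (𝓞 K))} {α : SatakeFamily K} (hα : IsSatakeFamilyOf P S α)
    {v : HeightOneSpectrum (𝓞 K)} (hv : v ∉ S) :
    ∃ x : Fin 2 → ℂ, (Finset.univ : Finset (Fin 2)).val.map x = α v ∧ (∀ i, x i ≠ 0) ∧
      (∀ a ∈ α v, ‖a‖ ≤ Real.sqrt v.residueCard) ∧ (∀ a ∈ α v, ‖a⁻¹‖ ≤ Real.sqrt v.residueCard) ∧
      ‖(α v).esymm 2‖ = 1 := by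
  obtain ⟨x, hx⟩ := exists_univ_val_map_eq (hα.card_eq hv)
  have he1 := norm_esymm_two_eq_one_of_isSatakeFamilyOf P hα hv
  have hbd : ∀ a ∈ α v, ‖a‖ ≤ Real.sqrt v.residueCard := fun a ha =>
    norm_satakeParameter_le_sqrt_two P hα hv ha
  have hprod : (α v).prod = x 0 * x 1 := by rw [← hx, Finset.prod_map_val, Fin.prod_univ_two]
  have he : (α v).esymm 2 = x 0 * x 1 := by
    have h := multisetEsymm_card_eq_prod (α v)
    rw [hα.card_eq hv] at h
    rw [h, hprod]
  have hmem : ∀ i, x i ∈ α v := fun i => by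
    rw [← hx]; exact Multiset.mem_map_of_mem _ (Finset.mem_univ_val i)
  have hx0 : ∀ i, x i ≠ 0 := by
    have h0 : x 0 * x 1 ≠ 0 := fun h => by
      rw [he, h, norm_zero] at he1
      exact zero_ne_one he1
    intro i
    fin_cases i
    · exact left_ne_zero_of_mul h0
    · exact right_ne_zero_of_mul h0
  have hmem' : ∀ a ∈ α v, a = x 0 ∨ a = x 1 := by
    intro a ha
    rw [← hx, Multiset.mem_map] at ha
    obtain ⟨i, -, rfl⟩ := ha
    fin_cases i
    · exact Or.inl rfl
    · exact Or.inr rfl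
  have hnorm : ‖x 0‖ * ‖x 1‖ = 1 := by rw [← norm_mul, ← he, he1]
  refine ⟨x, hx, hx0, hbd, fun a ha => ?_, he1⟩
  rcases hmem' a ha with rfl | rfl
  · have h1 : (x 0)⁻¹ = x 1 * (x 0 * x 1)⁻¹ := by field_simp [hx0 0, hx0 1]
    rw [h1, norm_mul, norm_inv, norm_mul, hnorm, inv_one, mul_one]
    exact hbd _ (hmem 1)
  · have h1 : (x 1)⁻¹ = x 0 * (x 0 * x 1)⁻¹ := by field_simp [hx0 0, hx0 1]
    rw [h1, norm_mul, norm_inv, norm_mul, hnorm, inv_one, mul_one]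
    exact hbd _ (hmem 0)

/-- `‖q_v^{-s}‖ = q_v^{-re s}` and `√q_v · q_v^{-re s} = q_v^{1/2 - re s}`. [folklore] -/
theorem sqrt_mul_rpow_neg_eq (v : HeightOneSpectrum (𝓞 K)) (σ : ℝ) :
    Real.sqrt v.residueCard * (v.residueCard : ℝ) ^ (-σ) = (v.residueCard : ℝ) ^ (1 / 2 - σ) := by
  have hq0 : (0 : ℝ) < v.residueCard := by exact_mod_cast (zero_lt_one.trans v.one_lt_residueCard)
  rw [Real.sqrt_eq_rpow, ← Real.rpow_add hq0, show (1 : ℝ) / 2 + -σ = 1 / 2 - σ by ring]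

/-- `q_v^{1/2 - σ} < 1` for `σ > 1/2`, and `q_v^{1/2 - σ} ≤ 1/2` for `σ ≥ 3/2` (`q_v ≥ 2`). [folklore] -/
theorem rpow_half_sub_lt_one (v : HeightOneSpectrum (𝓞 K)) {σ : ℝ} (hσ : 1 / 2 < σ) :
    (v.residueCard : ℝ) ^ (1 / 2 - σ) < 1 := by
  have hq1 : (1 : ℝ) < v.residueCard := by exact_mod_cast v.one_lt_residueCard
  exact Real.rpow_lt_one_of_one_lt_of_neg hq1 (by linarith)

/-- `q_v^{1/2 - σ} ≤ 1/2` for `σ ≥ 3/2` (`q_v ≥ 2`). [folklore] -/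
theorem rpow_half_sub_le_half (v : HeightOneSpectrum (𝓞 K)) {σ : ℝ} (hσ : 3 / 2 ≤ σ) :
    (v.residueCard : ℝ) ^ (1 / 2 - σ) ≤ 1 / 2 := by
  have hq2 : (2 : ℝ) ≤ v.residueCard := by exact_mod_cast v.one_lt_residueCard
  have hq0 : (0 : ℝ) < v.residueCard := by linarith
  calc (v.residueCard : ℝ) ^ (1 / 2 - σ) ≤ (v.residueCard : ℝ) ^ (-1 : ℝ) :=
        Real.rpow_le_rpow_of_exponent_le (by linarith) (by linarith)
    _ = (v.residueCard : ℝ)⁻¹ := Real.rpow_neg_one _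
    _ ≤ 2⁻¹ := by rw [inv_le_inv₀ hq0 two_pos]; exact hq2
    _ = 1 / 2 := by norm_num

variable {v : HeightOneSpectrum (𝓞 K)} [MeasurableSpace (v.adicCompletion K)] [BorelSpace (v.adicCompletion K)]
  {V : Type*} [AddCommGroup V] [Module ℂ V] (ρ : Representation ℂ (GL (Fin 2) (v.adicCompletion K)) V)

/-- **The unramified local Hecke integral at a good place, in the currency of the global Euler
factorisation** (Jacquet–Langlands (1970), Prop. 3.5: `Ψ(s, W_v) = L(s, π_v)` for the spherical `W_v`):
for `re s > 1/2`, with `α` the Hecke–Satake parameter (`|a| ≤ q_v^{1/2}`), `x₀` spherical with the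
eigenvalue equations, `ψ_v` of conductor `𝒪_v` and any Haar measure `μ'` of `K_vˣ`,
`a ↦ λ(ρ(diag(a,1)) x₀) |a|^{s-1/2}` is integrable with integral `μ'(𝒪_vˣ) λ(x₀) (∏_{a ∈ α}(1 - a q_v^{-s}))⁻¹`
(`integrable_and_integral_whittakerModel_diagGL2_mul_cpow`). [cite: JacquetLanglands1970, Prop. 3.5] -/
theorem integrable_and_integral_heckeIntegrand_spherical {ϖ : (v.adicCompletion K)ˣ}
    (hϖ : (ValuativeRel.valuation (v.adicCompletion K)).IsUniformizer (ϖ : v.adicCompletion K))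
    {ψ : AddChar (v.adicCompletion K) Circle} (hψ0 : ψ.HasConductorExp 0)
    {lam : Module.Dual ℂ V} (hlam : lam ∈ whittakerFunctionals ρ ψ)
    {x₀ : V} (hx₀ : x₀ ∈ ρ.fixedPoints (glInt 2 (v.adicCompletion K)))
    {α : Multiset ℂ} {x : Fin 2 → ℂ} (hx : (Finset.univ : Finset (Fin 2)).val.map x = α)
    (hT : ∀ r, 1 ≤ r → r ≤ 2 → heckeT ρ ϖ r x₀ =
      ((((Real.sqrt (residueFieldCard (v.adicCompletion K))) ^ (r * (2 - r)) : ℝ) : ℂ) * α.esymm r) • x₀)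
    (hbd : ∀ a ∈ α, ‖a‖ ≤ Real.sqrt v.residueCard)
    (μ' : Measure (v.adicCompletion K)ˣ) [μ'.IsHaarMeasure] {s : ℂ} (hs : 1 / 2 < s.re) :
    Integrable (fun y : (v.adicCompletion K)ˣ => lam (ρ (diagGL2 y 1) x₀) *
      (((normAbs (v.adicCompletion K) (y : v.adicCompletion K) : ℝ≥0) : ℝ) : ℂ) ^ (s - 1 / 2)) μ' ∧
    ∫ y : (v.adicCompletion K)ˣ, lam (ρ (diagGL2 y 1) x₀) *
        (((normAbs (v.adicCompletion K) (y : v.adicCompletion K) : ℝ≥0) : ℝ) : ℂ) ^ (s - 1 / 2) ∂μ' =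
      ((μ' {y : (v.adicCompletion K)ˣ | Valued.v (y : v.adicCompletion K) = 1}).toReal : ℂ) *
        lam x₀ * ((eulerPolynomial α).eval ((v.residueCard : ℂ) ^ (-s)))⁻¹ := by
  have hq : residueFieldCard (v.adicCompletion K) = v.residueCard := residueFieldCard_adicCompletion_eq K v
  have hq0 : (0 : ℝ) < v.residueCard := by exact_mod_cast (zero_lt_one.trans v.one_lt_residueCard)
  have hqs : ‖(v.residueCard : ℂ) ^ (-s)‖ = (v.residueCard : ℝ) ^ (-s.re) := by
    rw [Complex.norm_natCast_cpow_of_pos (zero_lt_one.trans v.one_lt_residueCard), Complex.neg_re]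
  have hs' : ∀ a ∈ α, ‖a * (residueFieldCard (v.adicCompletion K) : ℂ) ^ (-s)‖ < 1 := by
    intro a ha
    rw [hq, norm_mul, hqs]
    calc ‖a‖ * (v.residueCard : ℝ) ^ (-s.re) ≤ Real.sqrt v.residueCard * (v.residueCard : ℝ) ^ (-s.re) :=
          mul_le_mul_of_nonneg_right (hbd a ha) (Real.rpow_nonneg hq0.le _)
      _ = (v.residueCard : ℝ) ^ (1 / 2 - s.re) := sqrt_mul_rpow_neg_eq v s.re
      _ < 1 := rpow_half_sub_lt_one v hs
  have h := integrable_and_integral_whittakerModel_diagGL2_mul_cpow ρ hϖ hψ0 hlam hx₀ hx hT μ' hs'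
  refine ⟨h.1, ?_⟩
  have h2 := h.2
  simp only [whittakerModel_apply] at h2
  rw [h2, ← setOf_units_valued_eq_one_eq v, hq]
  simp only [eulerPolynomial]
  ring

/-- **The unramified local DUAL Hecke integral at a good place** (Jacquet–Langlands (1970), Prop. 3.5 with
Thm. 2.18 (iv): `Ψ̃(s, W_v) = L(s, π̃_v) = ∏_{a ∈ α}(1 - a⁻¹ q_v^{-s})⁻¹`): same statement for
`a ↦ W̃_v(diag(a,1)) |a|^{s-1/2}`, with the Euler factor of the inverted parameters (`|xᵢ⁻¹| ≤ q_v^{1/2}`).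
[cite: JacquetLanglands1970, Prop. 3.5, Thm. 2.18 (iv)] -/
theorem integrable_and_integral_dualHeckeIntegrand_spherical {ϖ : (v.adicCompletion K)ˣ}
    (hϖ : (ValuativeRel.valuation (v.adicCompletion K)).IsUniformizer (ϖ : v.adicCompletion K))
    {ψ : AddChar (v.adicCompletion K) Circle} (hψ0 : ψ.HasConductorExp 0)
    {lam : Module.Dual ℂ V} (hlam : lam ∈ whittakerFunctionals ρ ψ)
    {x₀ : V} (hx₀ : x₀ ∈ ρ.fixedPoints (glInt 2 (v.adicCompletion K)))
    {α : Multiset ℂ} {x : Fin 2 → ℂ} (hx : (Finset.univ : Finset (Fin 2)).val.map x = α)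
    (hxne : ∀ i, x i ≠ 0)
    (hT : ∀ r, 1 ≤ r → r ≤ 2 → heckeT ρ ϖ r x₀ =
      ((((Real.sqrt (residueFieldCard (v.adicCompletion K))) ^ (r * (2 - r)) : ℝ) : ℂ) * α.esymm r) • x₀)
    (hbd' : ∀ a ∈ α, ‖a⁻¹‖ ≤ Real.sqrt v.residueCard)
    (μ' : Measure (v.adicCompletion K)ˣ) [μ'.IsHaarMeasure] {s : ℂ} (hs : 1 / 2 < s.re) :
    Integrable (fun y : (v.adicCompletion K)ˣ => tildeFn (whittakerModel ρ lam x₀) (diagGL2 y 1) *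
      (((normAbs (v.adicCompletion K) (y : v.adicCompletion K) : ℝ≥0) : ℝ) : ℂ) ^ (s - 1 / 2)) μ' ∧
    ∫ y : (v.adicCompletion K)ˣ, tildeFn (whittakerModel ρ lam x₀) (diagGL2 y 1) *
        (((normAbs (v.adicCompletion K) (y : v.adicCompletion K) : ℝ≥0) : ℝ) : ℂ) ^ (s - 1 / 2) ∂μ' =
      ((μ' {y : (v.adicCompletion K)ˣ | Valued.v (y : v.adicCompletion K) = 1}).toReal : ℂ) *
        lam x₀ * ((eulerPolynomial (α.map (·⁻¹))).eval ((v.residueCard : ℂ) ^ (-s)))⁻¹ := by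
  have hq : residueFieldCard (v.adicCompletion K) = v.residueCard := residueFieldCard_adicCompletion_eq K v
  have hq0 : (0 : ℝ) < v.residueCard := by exact_mod_cast (zero_lt_one.trans v.one_lt_residueCard)
  have hqs : ‖(v.residueCard : ℂ) ^ (-s)‖ = (v.residueCard : ℝ) ^ (-s.re) := by
    rw [Complex.norm_natCast_cpow_of_pos (zero_lt_one.trans v.one_lt_residueCard), Complex.neg_re]
  have hs' : ∀ a ∈ α, ‖a⁻¹ * (residueFieldCard (v.adicCompletion K) : ℂ) ^ (-s)‖ < 1 := by
    intro a ha
    rw [hq, norm_mul, hqs]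
    calc ‖a⁻¹‖ * (v.residueCard : ℝ) ^ (-s.re) ≤ Real.sqrt v.residueCard * (v.residueCard : ℝ) ^ (-s.re) :=
          mul_le_mul_of_nonneg_right (hbd' a ha) (Real.rpow_nonneg hq0.le _)
      _ = (v.residueCard : ℝ) ^ (1 / 2 - s.re) := sqrt_mul_rpow_neg_eq v s.re
      _ < 1 := rpow_half_sub_lt_one v hs
  have h := integrable_and_integral_tildeFn_whittakerModel_diagGL2_mul_cpow ρ hϖ hψ0 hlam hx₀ hx hxne hT μ'
    hs'
  refine ⟨h.1, ?_⟩
  rw [h.2, ← setOf_units_valued_eq_one_eq v, hq]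
  simp only [eulerPolynomial]
  ring

/-- **Uniform absolute bounds for the unramified local Hecke integrals at the good places**
(Jacquet–Langlands (1970), p. 172: the Euler product of the absolute values converges for `re s` large):
for `re s ≥ 3/2`, with `C` the constant of `tsum_sq_mul_pow_le`,
`∫ |λ(ρ(diag(a,1)) x₀)| |a|^{re s - 1/2} dμ' ≤ μ'(𝒪_vˣ) |λ(x₀)| (1 + C q_v^{1/2 - re s})`, and the same for
the dual integrand (`integral_norm_whittakerModel_diagGL2_mul_cpow_le`,
`integral_norm_tildeFn_whittakerModel_diagGL2_mul_cpow_le` with `A = q_v^{1/2}`).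
[cite: JacquetLanglands1970, Prop. 3.5 and p. 172] -/
theorem integral_norm_heckeIntegrand_spherical_le {ϖ : (v.adicCompletion K)ˣ}
    (hϖ : (ValuativeRel.valuation (v.adicCompletion K)).IsUniformizer (ϖ : v.adicCompletion K))
    {ψ : AddChar (v.adicCompletion K) Circle} (hψ0 : ψ.HasConductorExp 0)
    {lam : Module.Dual ℂ V} (hlam : lam ∈ whittakerFunctionals ρ ψ)
    {x₀ : V} (hx₀ : x₀ ∈ ρ.fixedPoints (glInt 2 (v.adicCompletion K)))
    {α : Multiset ℂ} {x : Fin 2 → ℂ} (hx : (Finset.univ : Finset (Fin 2)).val.map x = α)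
    (hT : ∀ r, 1 ≤ r → r ≤ 2 → heckeT ρ ϖ r x₀ =
      ((((Real.sqrt (residueFieldCard (v.adicCompletion K))) ^ (r * (2 - r)) : ℝ) : ℂ) * α.esymm r) • x₀)
    (hbd : ∀ a ∈ α, ‖a‖ ≤ Real.sqrt v.residueCard) (he1 : ‖α.esymm 2‖ = 1)
    (μ' : Measure (v.adicCompletion K)ˣ) [μ'.IsHaarMeasure]
    {C : ℝ} (hC : ∀ y : ℝ, 0 ≤ y → y ≤ 1 / 2 →
      Summable (fun m : ℕ => ((m : ℝ) + 1) ^ 2 * y ^ m) ∧ ∑' m : ℕ, ((m : ℝ) + 1) ^ 2 * y ^ m ≤ 1 + C * y)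
    {s : ℂ} (hs : 3 / 2 ≤ s.re) :
    (∫ y : (v.adicCompletion K)ˣ, ‖lam (ρ (diagGL2 y 1) x₀) *
        (((normAbs (v.adicCompletion K) (y : v.adicCompletion K) : ℝ≥0) : ℝ) : ℂ) ^ (s - 1 / 2)‖ ∂μ' ≤
      (μ' {y : (v.adicCompletion K)ˣ | Valued.v (y : v.adicCompletion K) = 1}).toReal * ‖lam x₀‖ *
        (1 + C * (v.residueCard : ℝ) ^ (1 / 2 - s.re))) ∧
    (∫ y : (v.adicCompletion K)ˣ, ‖tildeFn (whittakerModel ρ lam x₀) (diagGL2 y 1) *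
        (((normAbs (v.adicCompletion K) (y : v.adicCompletion K) : ℝ≥0) : ℝ) : ℂ) ^ (s - 1 / 2)‖ ∂μ' ≤
      (μ' {y : (v.adicCompletion K)ˣ | Valued.v (y : v.adicCompletion K) = 1}).toReal * ‖lam x₀‖ *
        (1 + C * (v.residueCard : ℝ) ^ (1 / 2 - s.re))) := by
  have hq : residueFieldCard (v.adicCompletion K) = v.residueCard := residueFieldCard_adicCompletion_eq K v
  have hq0 : (0 : ℝ) < v.residueCard := by exact_mod_cast (zero_lt_one.trans v.one_lt_residueCard)
  have hA0 : (0 : ℝ) ≤ Real.sqrt v.residueCard := Real.sqrt_nonneg _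
  set yv : ℝ := (v.residueCard : ℝ) ^ (1 / 2 - s.re) with hyv
  have hyv' : Real.sqrt v.residueCard * (residueFieldCard (v.adicCompletion K) : ℝ) ^ (-s.re) = yv := by
    rw [hq]; exact sqrt_mul_rpow_neg_eq v s.re
  have hsA : Real.sqrt v.residueCard * (residueFieldCard (v.adicCompletion K) : ℝ) ^ (-s.re) < 1 := by
    rw [hyv']; exact rpow_half_sub_lt_one v (by linarith)
  have hy0 : 0 ≤ yv := Real.rpow_nonneg hq0.le _
  have hy2 : yv ≤ 1 / 2 := rpow_half_sub_le_half v hs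
  obtain ⟨-, hsum⟩ := hC yv hy0 hy2
  have hbd'' : ∀ a ∈ α, ‖a‖ ≤ Real.sqrt (residueFieldCard (v.adicCompletion K)) := by rw [hq]; exact hbd
  have h1 := (integral_norm_whittakerModel_diagGL2_mul_cpow_le ρ hϖ hψ0 hlam hx₀ hx hT μ'
    (A := Real.sqrt v.residueCard) hA0 hbd hsA).2
  have h2 := (integral_norm_tildeFn_whittakerModel_diagGL2_mul_cpow_le ρ hϖ hψ0 hlam hx₀ hx he1 hT μ'
    (A := Real.sqrt v.residueCard) hA0 hbd hsA).2
  rw [hyv'] at h1 h2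
  have hU : (μ' {y : (v.adicCompletion K)ˣ | ValuativeRel.valuation (v.adicCompletion K)
      (y : v.adicCompletion K) = 1}).toReal =
      (μ' {y : (v.adicCompletion K)ˣ | Valued.v (y : v.adicCompletion K) = 1}).toReal := by
    rw [setOf_units_valued_eq_one_eq v]
  have hkey : (μ' {y : (v.adicCompletion K)ˣ | ValuativeRel.valuation (v.adicCompletion K)
      (y : v.adicCompletion K) = 1}).toReal * (‖lam x₀‖ * ∑' m : ℕ, ((m : ℝ) + 1) ^ 2 * yv ^ m) ≤
      (μ' {y : (v.adicCompletion K)ˣ | Valued.v (y : v.adicCompletion K) = 1}).toReal * ‖lam x₀‖ *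
        (1 + C * yv) := by
    rw [hU, mul_assoc]
    exact mul_le_mul_of_nonneg_left (mul_le_mul_of_nonneg_left hsum (norm_nonneg _)) ENNReal.toReal_nonneg
  refine ⟨?_, h2.trans hkey⟩
  refine le_trans (le_of_eq ?_) (h1.trans hkey)
  refine integral_congr_ae (Eventually.of_forall fun y => ?_)
  simp only [whittakerModel_apply]

/-- **The partial Euler product of the DUAL Satake family converges for `re s > 3/2`**: for a Satake
family `α` of a cuspidal `Π ≤ L²(GL₂)` off `S`, the inverted parameters satisfy `|a⁻¹| ≤ q_v^{1/2}`
(`exists_enum_satakeParameter_two`), so `‖∏_{a}(1 - a⁻¹ q_v^{-s}) - 1‖ ≤ 3 q_v^{1/2 - re s}` is summable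
(`norm_eval_eulerPolynomial_sub_one_le`, `summable_residueCard_rpow_neg`, `summable_norm_inv_sub_one`;
the unconditional half-plane, as in `multipliable_partialStandardL_of_lt_re`). [folklore] -/
theorem multipliable_partialEuler_dualFamily_of_lt_re (P : CuspidalAutomorphicRepGL 2 K μ)
    {S : Set (HeightOneSpectrum (𝓞 K))} {α : SatakeFamily K} (hα : IsSatakeFamilyOf P S α)
    {s : ℂ} (hs : 3 / 2 < s.re) :
    Multipliable fun v : {v : HeightOneSpectrum (𝓞 K) // v ∉ S} =>
      ((eulerPolynomial (dualFamily α v.1)).eval ((v.1.residueCard : ℂ) ^ (-s)))⁻¹ := by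
  have ht1 : 1 < s.re - 1 / 2 := by linarith
  let b : {v : HeightOneSpectrum (𝓞 K) // v ∉ S} → ℝ := fun v =>
    (2 ^ 2 - 1) * (v.1.residueCard : ℝ) ^ (-(s.re - 1 / 2))
  have hb : Summable b := ((summable_residueCard_rpow_neg ht1).subtype _).mul_left (2 ^ 2 - 1)
  have hsum : Summable fun v : {v : HeightOneSpectrum (𝓞 K) // v ∉ S} =>
      ‖((eulerPolynomial (dualFamily α v.1)).eval ((v.1.residueCard : ℂ) ^ (-s)))⁻¹ - 1‖ := by
    refine summable_norm_inv_sub_one hb fun v => ?_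
    obtain ⟨x, -, -, -, hinv, -⟩ := exists_enum_satakeParameter_two P hα v.2
    have hq1 : (1 : ℝ) < v.1.residueCard := by exact_mod_cast v.1.one_lt_residueCard
    have hq0 : (0 : ℝ) < v.1.residueCard := zero_lt_one.trans hq1
    have hx : ‖(v.1.residueCard : ℂ) ^ (-s)‖ ≤ (v.1.residueCard : ℝ) ^ (-s.re) := by
      rw [Complex.norm_natCast_cpow_of_pos (zero_lt_one.trans v.1.one_lt_residueCard), Complex.neg_re]
    have hprod : Real.sqrt v.1.residueCard * (v.1.residueCard : ℝ) ^ (-s.re) =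
        (v.1.residueCard : ℝ) ^ (-(s.re - 1 / 2)) := by
      rw [sqrt_mul_rpow_neg_eq v.1 s.re]
      congr 1
      ring
    have hBt : Real.sqrt v.1.residueCard * (v.1.residueCard : ℝ) ^ (-s.re) ≤ 1 := by
      rw [sqrt_mul_rpow_neg_eq v.1 s.re]
      exact (rpow_half_sub_lt_one v.1 (by linarith)).le
    have hdual : ∀ a ∈ dualFamily α v.1, ‖a‖ ≤ Real.sqrt v.1.residueCard := by
      intro a ha
      rw [dualFamily_apply, Multiset.mem_map] at ha
      obtain ⟨b', hb', rfl⟩ := ha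
      exact hinv b' hb'
    obtain ⟨h1, -⟩ := norm_eval_eulerPolynomial_sub_one_le (Real.sqrt_nonneg _) hx hBt
      (dualFamily α v.1) hdual
    refine h1.trans ?_
    rw [hprod]
    refine mul_le_mul_of_nonneg_right ?_ (Real.rpow_nonneg hq0.le _)
    have hcard : Multiset.card (dualFamily α v.1) = 2 := by
      rw [dualFamily_apply, Multiset.card_map, hα.card_eq v.2]
    rw [hcard]
  refine (multipliable_one_add_of_summable hsum).congr fun v => ?_
  simp only [add_sub_cancel]

/-- **Absolute convergence of the local Hecke integrals of an ARBITRARY vector, direct and dual, for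
`re s` large** (Jacquet–Langlands (1970), Prop. 2.10 / Thm. 2.18: `Ψ(s, W_u)` and `Ψ̃(s, W_u)` converge
absolutely in a right half-plane): for an irreducible smooth `ρ` of `GL₂(K_v)` (finite-dimensional Jacquet
module, `finiteDimensional_coinvariants_of_smoothIrrep_fin_two`), a `ψ`-Whittaker functional `λ` and
`u ∈ V_ρ`, both `a ↦ λ(ρ(diag(a,1)) u) |a|^{s-1/2}` and `a ↦ W̃_u(diag(a,1)) |a|^{s-1/2}` are integrable for
`re s > c(u)` (`exists_forall_integrable_whittakerModel_mul_cpow` for `ρ` and for the twist `ρ ∘ ι`, whose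
Whittaker functions are the `W̃`, `tildeFn_whittakerModel`). [cite: JacquetLanglands1970, Prop. 2.10, Thm. 2.18] -/
theorem exists_forall_integrable_heckeIntegrand_and_dual {V₀ : Type} [AddCommGroup V₀] [Module ℂ V₀]
    (ρ₀ : Representation ℂ (GL (Fin 2) (v.adicCompletion K)) V₀) (hirr : ρ₀.IsIrreducible) (hsm : ρ₀.IsSmooth)
    {ψ : AddChar (v.adicCompletion K) Circle} (hψ : ψ.IsContinuousNontrivial)
    {lam : Module.Dual ℂ V₀} (hlam : lam ∈ whittakerFunctionals ρ₀ ψ)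
    (μ' : Measure (v.adicCompletion K)ˣ) [IsFiniteMeasureOnCompacts μ'] [μ'.IsMulLeftInvariant] (u : V₀) :
    ∃ c : ℝ, ∀ s : ℂ, c < s.re →
      Integrable (fun y : (v.adicCompletion K)ˣ => lam (ρ₀ (diagGL2 y 1) u) *
        (((normAbs (v.adicCompletion K) (y : v.adicCompletion K) : ℝ≥0) : ℝ) : ℂ) ^ (s - 1 / 2)) μ' ∧
      Integrable (fun y : (v.adicCompletion K)ˣ => tildeFn (whittakerModel ρ₀ lam u) (diagGL2 y 1) *
        (((normAbs (v.adicCompletion K) (y : v.adicCompletion K) : ℝ≥0) : ℝ) : ℂ) ^ (s - 1 / 2)) μ' := by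
  haveI := hirr
  haveI : FiniteDimensional ℂ
      (Representation.restrictUnipotentGL (v.adicCompletion K) (id : Fin 2 → Fin 2) ρ₀).Coinvariants :=
    finiteDimensional_coinvariants_of_smoothIrrep_fin_two ⟨V₀, ρ₀, hirr, hsm⟩
  obtain ⟨c₁, hc₁⟩ := exists_forall_integrable_whittakerModel_mul_cpow ρ₀ hsm hψ hlam μ' u 1
  -- the twist `ρ ∘ ι`, whose Whittaker functions are the `W̃`
  set ρι : Representation ℂ (GL (Fin 2) (v.adicCompletion K)) V₀ :=
    ρ₀.comp (GaloisRepresentations.glTransposeInv (Fin 2) (v.adicCompletion K)).toMonoidHom with hρι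
  haveI hριi : ρι.IsIrreducible := (isIrreducible_twist_iff (π := ρ₀)).2 hirr
  have hsmι : ρι.IsSmooth := isSmooth_twist hsm
  haveI : FiniteDimensional ℂ
      (Representation.restrictUnipotentGL (v.adicCompletion K) (id : Fin 2 → Fin 2) ρι).Coinvariants :=
    finiteDimensional_coinvariants_of_smoothIrrep_fin_two ⟨V₀, ρι, hριi, hsmι⟩
  have hlamι : lam.comp (ρ₀ (weylLong 2 (v.adicCompletion K))) ∈ whittakerFunctionals ρι ψ⁻¹ :=
    comp_weylLong_mem_whittakerFunctionals_twist hlam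
  obtain ⟨c₂, hc₂⟩ := exists_forall_integrable_whittakerModel_mul_cpow ρι hsmι hψ.inv hlamι μ' u 1
  refine ⟨max c₁ c₂, fun s hs => ⟨?_, ?_⟩⟩
  · have h := hc₁ s (lt_of_le_of_lt (le_max_left _ _) hs)
    refine h.congr (Eventually.of_forall fun y => ?_)
    simp only [whittakerModel_apply, mul_one]
  · have h := hc₂ s (lt_of_le_of_lt (le_max_right _ _) hs)
    refine h.congr (Eventually.of_forall fun y => ?_)
    simp only [mul_one, hρι, tildeFn_whittakerModel]

end Local

/-! ### 2. The Euler factorisation `(E′)` of the global Hecke integral of pure tensors -/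

section Main

-- the house Borel structures on `GL₂(𝔸_K)` (as in `PureTensorCuspForm`, `HeckeJPSSIntegralUnfoldedGL2`)
attribute [local instance] adelicBorel borelSpace_adelic locallyCompactSpace_adelic
  secondCountableTopology_gl_adelic glAdeleBorel borelSpace_glAdele

set_option backward.isDefEq.respectTransparency false

section Continuity

variable {K : Type} [Field K] [NumberField K]

/-- `a ↦ diag(a, 1)` is continuous `𝕀_K → GL₂(𝔸_K)`. [folklore] -/
theorem continuous_glDiagonal_vecCons_one :
    Continuous fun a : ideleGroup K => glDiagonal 2 (AdeleRing (𝓞 K) K) ![a, 1] := by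
  refine (continuous_glDiagonal (n := 2) (AdeleRing (𝓞 K) K)).comp (continuous_pi fun i => ?_)
  fin_cases i
  · exact continuous_id
  · exact continuous_const

/-- `a ↦ ‖a‖^z` is continuous on `𝕀_K` (`‖a‖ > 0`). [folklore] -/
theorem continuous_ideleNorm_coe_cpow (z : ℂ) :
    Continuous fun a : ideleGroup K => ((IdeleClassGroup.ideleNorm K a : ℝ) : ℂ) ^ z := by
  refine (Complex.continuous_ofReal.comp ?_).cpow continuous_const fun a => Or.inl ?_
  · exact NNReal.continuous_coe.comp (continuous_ideleNorm_holds K)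
  · rw [Function.comp_apply, Complex.ofReal_re]
    exact NNReal.coe_pos.2 (pos_iff_ne_zero.2 (ideleNorm_ne_zero a))

/-- The Hecke integrand `a ↦ W_Φ(diag(a,1)) ‖a‖^z` of a continuous `Φ` is continuous. [folklore] -/
theorem continuous_heckeIntegrand_of_continuous {Φ : GL (Fin 2) (AdeleRing (𝓞 K) K) → ℂ} (hΦ : Continuous Φ)
    (z : ℂ) :
    Continuous fun a : ideleGroup K =>
      whittakerDepth 0 Φ (glDiagonal 2 (AdeleRing (𝓞 K) K) ![a, 1]) * ((IdeleClassGroup.ideleNorm K a : ℝ) : ℂ) ^ z :=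
  ((continuous_whittakerDepth hΦ 0).comp continuous_glDiagonal_vecCons_one).mul (continuous_ideleNorm_coe_cpow z)

/-- The dual Hecke integrand `a ↦ W̃_Φ(diag(a,1)) ‖a‖^z` of a continuous `Φ` is continuous. [folklore] -/
theorem continuous_dualHeckeIntegrand_of_continuous {Φ : GL (Fin 2) (AdeleRing (𝓞 K) K) → ℂ} (hΦ : Continuous Φ)
    (z : ℂ) :
    Continuous fun a : ideleGroup K =>
      tildeFn (whittakerDepth 0 Φ) (glDiagonal 2 (AdeleRing (𝓞 K) K) ![a, 1]) *
        ((IdeleClassGroup.ideleNorm K a : ℝ) : ℂ) ^ z := by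
  refine Continuous.mul ?_ (continuous_ideleNorm_coe_cpow z)
  exact (continuous_whittakerDepth hΦ 0).comp
    ((continuous_const.mul (map_continuous _)).comp continuous_glDiagonal_vecCons_one)

end Continuity

set_option maxHeartbeats 1600000 in
/-- **Jacquet–Langlands (1970), (11.1.2) (p. 171), p. 172 and Lemma 11.1.3 — hypothesis `(E′)` of
`integralRepresentation_clean_of_archHeckeTestVector_of_heckeEulerFactorisation'`, PROVED.** For a cuspidal
`Π ≤ L²_cusp(GL₂(K) A_G \ GL₂(𝔸_K))` there are: a finite set `S₀` of finite places and a Satake family `α`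
of `Π` off `S₀`; the archimedean component `τ` of `Π` (irreducible, unitary) with a non-zero continuous
`ψ_∞`-Whittaker functional `ℓ_∞` on its Gårding space and a Haar measure `μ_∞` of `K_∞ˣ`; irreducible
smooth local components `ρ_u` of `Π` at all finite places (in the `L²` sense) with non-zero
`ψ_u`-Whittaker functionals `λ_u`; invariant measures `ν_u` on `GL₁(K_u) ⧸ U₁` — such that for every
finite `S ⊇ S₀`, all local vectors `t_u ∈ V_{ρ_u}` (`u ∈ S`) and every `K_∞`-finite Gårding vector `e₀`
of `τ` whose two archimedean Hecke integrands are `μ_∞`-integrable for `re s > x₁`, there are ENTIRE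
functions `Z`, `Z'` with `Z(s) = Z'(1 - s)` and, for `re s > c`,

  `Z(s) = Ψ_∞(s; e₀) · ∏_{u ∈ S} Ψ(s; W_{t_u}, 𝟙) · L^S(s, α)`,
  `Z'(s) = Ψ̃_∞(s; e₀) · ∏_{u ∈ S} Ψ(s; W̃_{t_u}, 𝟙) · L^S(s, α∨)`:

`Z`, `Z'` are (a constant multiple of) the global Hecke integrals `∫ φ(diag(a,1)) |a|^{s-1/2}` of the cusp
form `φ` of the pure tensor `e₀ ⊗ (⊗_{u ∈ S} t_u) ⊗ (⊗_{u ∉ S} x₀_u)` and of its `ι̂`-substitute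
(`isCuspFormGL_invQuot_contRep_pureTensor`; entire by `differentiable_jpssIntegral`; the functional
equation is the substitution `g ↦ ᵗg⁻¹`, Lemma 11.1.3 / `jpssIntegral_comp_glTransposeInvQuot`); they
unfold to `∫_𝕀 W_φ(diag(a,1)) |a|^{s-1/2}` (p. 171; `exists_jpssIntegral_two_one_and_dual_eq_mul_integral_idele`)
which factor over the places ((11.1.2); `integral_heckeIntegrand_pureTensor_eq_mul_tprod` and its dual,
absolutely convergent by `integrable_heckeIntegrand_pureTensor`, p. 172), the good local factors being
`L(s, π_u)` and `L(s, π̃_u)` (Prop. 3.5; the Hecke–Satake eigenvalues of `Π` transported to the Flath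
factors, `heckeT_eq_smul_of_isSatakeFamilyOf_of_hasLocalComponentAt`).
[cite: JacquetLanglands1970, (11.1.2) p. 171, p. 172, Lemma 11.1.3] [cite: CogdellAnalyticTheory2004, §2.3 Thm. 2.2] -/
theorem heckeEulerFactorisationGL2' {K : Type} [Field K] [NumberField K]
    (hcpt : isCompact_glFiniteIntegralLevel 2 K)
    (μ : Measure (AdelicGroupData.gl 2 K).automorphicQuotient) [(AdelicGroupData.gl 2 K).IsAutomorphicMeasure μ]
    (Pl : CuspidalAutomorphicRepGL 2 K μ)
    [MeasurableSpace ((mixedSpace K)ˣ)] [BorelSpace ((mixedSpace K)ˣ)]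
    [∀ u : HeightOneSpectrum (𝓞 K), MeasurableSpace (u.adicCompletion K)]
    [∀ u : HeightOneSpectrum (𝓞 K), BorelSpace (u.adicCompletion K)]
    [∀ u : HeightOneSpectrum (𝓞 K),
      MeasurableSpace (GL (Fin 1) (u.adicCompletion K) ⧸ upperUnitriangular (Fin 1) (u.adicCompletion K))]
    [∀ u : HeightOneSpectrum (𝓞 K),
      BorelSpace (GL (Fin 1) (u.adicCompletion K) ⧸ upperUnitriangular (Fin 1) (u.adicCompletion K))] :
    ∃ (S₀ : Finset (HeightOneSpectrum (𝓞 K))) (αf : SatakeFamily K)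
      (_ : IsSatakeFamilyOf Pl (S₀ : Set (HeightOneSpectrum (𝓞 K))) αf)
      (E : Type) (_ : NormedAddCommGroup E) (_ : InnerProductSpace ℂ E) (_ : CompleteSpace E)
      (τ : ContRepresentation ℂ (AutomorphyDatum.gl 2 K hcpt).arch.carrier E) (hτ : τ.IsStronglyContinuous)
      (_ : τ.IsUnitary) (_ : τ.IsTopIrreducible) (_ : ∃ T ∈ archIntertwiners hcpt τ Pl.1, T ≠ 0)
      (ℓ : archGardingSpace hcpt τ →ₗ[ℂ] ℂ) (_ : IsArchContWhittakerFunctional hcpt τ hτ ℓ) (_ : ℓ ≠ 0)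
      (μi : Measure ((mixedSpace K)ˣ)) (_ : IsHaarMeasure μi)
      (Vl : HeightOneSpectrum (𝓞 K) → Type) (_ : ∀ u, AddCommGroup (Vl u)) (_ : ∀ u, Module ℂ (Vl u))
      (ρ : ∀ u : HeightOneSpectrum (𝓞 K), Representation ℂ (GL (Fin 2) (u.adicCompletion K)) (Vl u))
      (_ : ∀ u, (ρ u).IsIrreducible) (_ : ∀ u, (ρ u).IsSmooth)
      (_ : ∀ u, Automorphic.HasLocalComponentAt Pl.1 u (ρ u))
      (Λ : ∀ u, Module.Dual ℂ (Vl u))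
      (_ : ∀ u, Λ u ∈ whittakerFunctionals (ρ u) ((adeleAddChar K).adicComponent u)) (_ : ∀ u, Λ u ≠ 0)
      (ν : ∀ u : HeightOneSpectrum (𝓞 K),
        Measure (GL (Fin 1) (u.adicCompletion K) ⧸ upperUnitriangular (Fin 1) (u.adicCompletion K)))
      (_ : ∀ u, SMulInvariantMeasure (GL (Fin 1) (u.adicCompletion K))
        (GL (Fin 1) (u.adicCompletion K) ⧸ upperUnitriangular (Fin 1) (u.adicCompletion K)) (ν u))
      (_ : ∀ u, IsFiniteMeasureOnCompacts (ν u)) (_ : ∀ u, (ν u).IsOpenPosMeasure),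
      ∀ (S : Finset (HeightOneSpectrum (𝓞 K))), S₀ ⊆ S →
      ∀ (t : ∀ u, Vl u) (e₀ : archGardingSpace hcpt τ),
        FiniteDimensional ℂ (Submodule.span ℂ (Set.range
          fun κ : (AutomorphyDatum.gl 2 K hcpt).arch.maximalCompact =>
            τ (toArch hcpt (κ : GL (Fin 2) (mixedSpace K))) (e₀ : E))) →
      ∀ x₁ : ℝ, (∀ s : ℂ, x₁ < s.re →
          Integrable (fun u : (mixedSpace K)ˣ => kirillovFn hτ ℓ e₀ u *
            ((mixedEmbedding.norm ((u : (mixedSpace K)ˣ) : mixedSpace K) : ℝ) : ℂ) ^ (s - 1 / 2)) μi ∧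
          Integrable (fun u : (mixedSpace K)ˣ =>
            tildeFn (fun g : GL (Fin 2) (mixedSpace K) =>
                ℓ ⟨τ (toArch hcpt g) (e₀ : E), apply_mem_archGardingSpace hτ _ e₀.2⟩) (diagGL2 u 1) *
              ((mixedEmbedding.norm ((u : (mixedSpace K)ˣ) : mixedSpace K) : ℝ) : ℂ) ^ (s - 1 / 2)) μi) →
        ∃ (Z Z' : ℂ → ℂ) (c : ℝ), Differentiable ℂ Z ∧ Differentiable ℂ Z' ∧ (∀ s, Z s = Z' (1 - s)) ∧
          (∀ s : ℂ, c < s.re → Z s =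
            (∫ u : (mixedSpace K)ˣ, kirillovFn hτ ℓ e₀ u *
                ((mixedEmbedding.norm ((u : (mixedSpace K)ˣ) : mixedSpace K) : ℝ) : ℂ) ^ (s - 1 / 2) ∂μi) *
              (∏ u ∈ S, rsZeta Nat.one_lt_two (ν u) (whittakerModel (ρ u) (Λ u) (t u)) (fun _ => 1) s) *
              partialStandardL (S : Set (HeightOneSpectrum (𝓞 K))) αf s) ∧
          (∀ s : ℂ, c < s.re → Z' s =
            (∫ u : (mixedSpace K)ˣ,
                tildeFn (fun g : GL (Fin 2) (mixedSpace K) =>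
                    ℓ ⟨τ (toArch hcpt g) (e₀ : E), apply_mem_archGardingSpace hτ _ e₀.2⟩) (diagGL2 u 1) *
                  ((mixedEmbedding.norm ((u : (mixedSpace K)ˣ) : mixedSpace K) : ℝ) : ℂ) ^ (s - 1 / 2) ∂μi) *
              (∏ u ∈ S, rsZeta Nat.one_lt_two (ν u) (tildeFn (whittakerModel (ρ u) (Λ u) (t u)))
                (fun _ => 1) s) *
              partialStandardL (S : Set (HeightOneSpectrum (𝓞 K))) (dualFamily αf) s) := by
  classical
  /- topological and measurable structures -/
  haveI : T2Space (GL (Fin 2) (AdeleRing (𝓞 K) K)) := t2Space_gl 2 K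
  haveI : LocallyCompactSpace (GL (Fin 2) (AdeleRing (𝓞 K) K)) :=
    AdelicGroupData.locallyCompactSpace_generalLinearGroup_adeleRing K (Fin 2)
  haveI := secondCountableTopology_generalLinearGroup_adeleRing K (Fin 2)
  haveI : LocallyCompactSpace (GL (Fin 1) (AdeleRing (𝓞 K) K)) :=
    AdelicGroupData.locallyCompactSpace_generalLinearGroup_adeleRing K (Fin 1)
  haveI : T2Space (AdeleRing (𝓞 K) K) := t2Space_adeleRing K
  haveI := locallyCompactSpace_ideleGroup K
  haveI := secondCountableTopology_ideleGroup K
  haveI := secondCountableTopology_adeleRing K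
  haveI := locallyCompactSpace_adeleRing' K
  haveI : LocallyCompactSpace ↥(adelicUnipotent 2 K) := (isClosed_adelicUnipotent 2 K).locallyCompactSpace
  haveI : SecondCountableTopology (AdelicGroupData.gl 2 K).Adelic :=
    secondCountableTopology_generalLinearGroup_adeleRing K (Fin 2)
  letI mI : MeasurableSpace (ideleGroup K) := borel _
  haveI : BorelSpace (ideleGroup K) := ⟨rfl⟩
  haveI hBu : ∀ u : HeightOneSpectrum (𝓞 K), BorelSpace ((u.adicCompletion K)ˣ) := fun u => Units.borelSpace
  /- Haar measures -/
  set ν₀ : Measure ↥(adelicUnipotent 2 K) := Measure.haar with hν₀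
  set νG : Measure (GL (Fin 1) (AdeleRing (𝓞 K) K)) := Measure.haar with hνG
  obtain ⟨νI, hνIdef⟩ : ∃ νI : Measure (ideleGroup K),
      νI = νG.map (Matrix.GeneralLinearGroup.det : GL (Fin 1) (AdeleRing (𝓞 K) K) →* ideleGroup K) :=
    ⟨_, rfl⟩
  haveI hνI : IsHaarMeasure νI := by rw [hνIdef]; exact isHaarMeasure_map_det_fin_one (K := K) νG
  set μi : Measure (mixedSpace K)ˣ := Measure.haar with hμi
  obtain ⟨μ₁, hμ₁⟩ : AdelicGroupData.exists_isAutomorphicMeasure_gl 1 K :=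
    AdelicGroupData.exists_isAutomorphicMeasure_gl_holds 1 K
  haveI := hμ₁
  -- the local Haar measures `μ_u` of `K_uˣ` and the invariant measures `ν_u` on `GL₁(K_u) ⧸ U₁`
  have hq := fun u : HeightOneSpectrum (𝓞 K) =>
    Literature.NumberTheory.EllipticCurves.Hida2000Thm326.exists_haar_measure_quotient_fin_one
      (F := u.adicCompletion K)
  choose μv hμv νq hν₁ hν₂ hν₃ hνint using hq
  haveI : ∀ u, (μv u).IsHaarMeasure := hμv
  /- the Satake family and the ramification of `ψ` -/
  obtain ⟨Ssat, αf, -, hαf⟩ := exists_isSatakeFamilyOf_holds (n := 2) (K := K) (μ := μ) Pl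
  obtain ⟨Sψ, hSψ⟩ : ∃ Sψ : Finset (HeightOneSpectrum (𝓞 K)),
      ∀ v ∉ Sψ, ((adeleAddChar K).adicComponent v).HasConductorExp 0 := by
    refine ⟨(Filter.eventually_cofinite.1
      (eventually_hasConductorExp_zero_adicComponent_adeleAddChar (K := K))).toFinset, fun v hv => ?_⟩
    by_contra h
    exact hv ((Set.Finite.mem_toFinset _).2 h)
  /- the archimedean component and the line of the finite Whittaker model -/
  obtain ⟨E, _, _, _, τ, hτi, hτu, hτc, hex, -⟩ := exists_archComponent_decomposition (hcpt := hcpt) Pl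
  set ℓ := whittakerFunctional ν₀ (continuous_adeleAddChar K) (ContRepresentation.Equiv.refl Pl.1.toContRep)
    with hℓ
  have hψ : IsGlobalAddChar K (adeleAddChar K) := isGlobalAddChar_adeleAddChar (K := K)
  have hℓW : IsContWhittakerFunctional Pl.1 (adeleAddChar K) ℓ :=
    isContWhittakerFunctional_whittakerFunctional ν₀ (continuous_adeleAddChar K) hψ _
  have hℓ0 : ℓ ≠ 0 := by
    letI : MeasurableSpace (AdeleRing (𝓞 K) K) := borel _
    haveI : BorelSpace (AdeleRing (𝓞 K) K) := ⟨rfl⟩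
    obtain ⟨T, hT, hT0⟩ := id hex
    have hxE : ∃ x : E, T x ≠ 0 := by
      by_contra h
      push Not at h
      exact hT0 (ContinuousLinearMap.ext h)
    obtain ⟨xE, hxE⟩ := hxE
    have hf0 : (⟨T xE, hT.1 xE⟩ : Pl.1.toSubmodule) ≠ 0 := fun h => hxE (congrArg Subtype.val h)
    exact whittakerFunctional_refl_ne_zero (by norm_num : 1 ≤ 2) ν₀ Pl.2.1 hf0
  obtain ⟨T₀, Λ₀, hΛ₀W, hΛ1, hne, hΛ⟩ := exists_finWhittaker_transferMap_eq_smul Pl hτu hτi hτc hex hℓW hℓ0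
  have hℓiW : IsArchContWhittakerFunctional hcpt τ hτc (transferMap ℓ hτc T₀) :=
    transferMap_mem_archContWhittakerFunctionals hℓW hτc T₀
  have hΛ₀ne : Λ₀ ≠ 0 := fun h => by
    rw [h, LinearMap.zero_apply] at hΛ1
    exact zero_ne_one hΛ1
  /- Flath's factorisation of `π_f` and the product formula for `Λ₀` -/
  obtain ⟨V, _, _, ρ, x₀, j, Sfl, lam, eu, hρ, hx₀fix, -, -, -, -, hlamW, hlam0, hlam1, -, hslot, hprod,
    hnondeg, hloc⟩ := exists_finWhittaker_prod_formula hcpt Pl hτu hτi hex hΛ₀W hΛ₀ne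
  obtain ⟨Sfix, hSfix⟩ : ∃ Sfix : Finset (HeightOneSpectrum (𝓞 K)),
      ∀ v ∉ Sfix, x₀ v ∈ (ρ v).fixedPoints (glInt 2 (v.adicCompletion K)) := by
    refine ⟨(Filter.eventually_cofinite.1 hx₀fix).toFinset, fun v hv => ?_⟩
    by_contra h
    exact hv ((Set.Finite.mem_toFinset _).2 h)
  obtain ⟨xg, hxg⟩ := hnondeg
  obtain ⟨Sg, hSg⟩ : ∃ Sg : Finset (HeightOneSpectrum (𝓞 K)), ∀ v ∉ Sg, xg v = x₀ v := by
    refine ⟨(Filter.eventually_cofinite.1 xg.eventually_eq).toFinset, fun v hv => ?_⟩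
    by_contra h
    exact hv ((Set.Finite.mem_toFinset _).2 h)
  /- the exceptional set -/
  set S₀ : Finset (HeightOneSpectrum (𝓞 K)) := Ssat ∪ Sψ ∪ Sfix ∪ Sg with hS₀
  have hSsat₀ : Ssat ⊆ S₀ :=
    Finset.subset_union_left.trans (Finset.subset_union_left.trans Finset.subset_union_left)
  have hSψ₀ : Sψ ⊆ S₀ :=
    Finset.subset_union_right.trans (Finset.subset_union_left.trans Finset.subset_union_left)
  have hSfix₀ : Sfix ⊆ S₀ := Finset.subset_union_right.trans Finset.subset_union_left
  have hSg₀ : Sg ⊆ S₀ := Finset.subset_union_right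
  have hαf₀ : IsSatakeFamilyOf Pl (S₀ : Set (HeightOneSpectrum (𝓞 K))) αf :=
    hαf.mono (Finset.coe_subset.2 hSsat₀)
  refine ⟨S₀, αf, hαf₀, E, inferInstance, inferInstance, inferInstance, τ, hτc, hτu, hτi, hex, transferMap ℓ hτc T₀,
    hℓiW, hne, μi, inferInstance, V, inferInstance, inferInstance, ρ, fun u => (hρ u).1,
    fun u => (hρ u).2.isSmooth, hloc, lam, hlamW, hlam0, νq, hν₁, hν₂, hν₃, ?_⟩
  intro S hS t e₀ he₀ x₁ hI
  have hαfS : IsSatakeFamilyOf Pl (S : Set (HeightOneSpectrum (𝓞 K))) αf :=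
    hαf₀.mono (Finset.coe_subset.2 hS)
  /- the pure tensor `φ = e₀ ⊗ (⊗_{v ∈ S} t_v) ⊗ (⊗_{v ∉ S} x₀_v)` and its cusp form -/
  obtain ⟨x, hxdef⟩ : ∃ x : RestrictedFamily V x₀, x = RestrictedFamily.extend S (fun v : ↥S => t v) :=
    ⟨_, rfl⟩
  have hxS : ∀ v ∉ S, x v = x₀ v := fun v hv => by
    rw [hxdef]; exact RestrictedFamily.extend_apply_of_notMem S _ hv
  have hxS' : ∀ v ∈ S, x v = t v := fun v hv => by
    rw [hxdef]; exact RestrictedFamily.extend_apply_of_mem S _ hv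
  have hfix : ∀ v ∉ S, x₀ v ∈ (ρ v).fixedPoints (glInt 2 (v.adicCompletion K)) :=
    fun v hv => hSfix v fun h => hv (hS (hSfix₀ h))
  have hψ0 : ∀ v ∉ S, ((adeleAddChar K).adicComponent v).HasConductorExp 0 :=
    fun v hv => hSψ v fun h => hv (hS (hSψ₀ h))
  have hsat : ∀ v ∉ S, v ∉ (Ssat : Set (HeightOneSpectrum (𝓞 K))) :=
    fun v hv h => hv (hS (hSsat₀ (Finset.mem_coe.1 h)))
  obtain ⟨φ, hφdef⟩ : ∃ φ : (AdelicGroupData.gl 2 K).automorphicQuotient → ℂ,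
      φ = contRep (((j x : multiplicityModule hcpt τ Pl.1) : E →L[ℂ] (AdelicGroupData.gl 2 K).L2 μ) (e₀ : E)) :=
    ⟨_, rfl⟩
  have hφ : IsCuspFormGL 2 K hcpt (invQuot (AdelicGroupData.gl 2 K) φ) := by
    rw [hφdef]; exact isCuspFormGL_invQuot_contRep_pureTensor Pl (j x) (e₀ : E) he₀
  /- the constants -/
  obtain ⟨C, hC, hunf⟩ := exists_jpssIntegral_two_one_and_dual_eq_mul_integral_idele (K := K) μ₁ νG
  obtain ⟨cS, hcS, -⟩ := exists_splittingConst_ideleUnitBox_compl νI μi μv S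
  have hcS0 : cS ≠ 0 := ne_zero_of_map_restrict_ideleUnitBox_compl_eq_smul νI S _ hcS
  have hΛS : Λ₀ (j (RestrictedFamily.extend S fun v : ↥S => eu v)) ≠ 0 := by
    have h := hslot S xg (RestrictedFamily.extend S fun v : ↥S => eu v)
      (fun v hv => RestrictedFamily.extend_apply_of_mem S _ hv)
      (fun v hv => by
        rw [RestrictedFamily.extend_apply_of_notMem S _ hv, hSg v fun h => hv (hS (hSg₀ h))])
    intro h0
    apply hxg
    rw [h, h0, zero_mul]
  obtain ⟨k₀, hk₀⟩ : ∃ k₀ : ℂ, k₀ = (C : ℂ) * (cS : ℂ) * Λ₀ (j (RestrictedFamily.extend S fun v : ↥S => eu v)) :=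
    ⟨_, rfl⟩
  have hC0 : (C : ℂ) ≠ 0 := by exact_mod_cast hC.ne'
  have hcS0' : ((cS : ℝ) : ℂ) ≠ 0 := by exact_mod_cast hcS0
  have hk₀0 : k₀ ≠ 0 := by rw [hk₀]; exact mul_ne_zero (mul_ne_zero hC0 hcS0') hΛS
  /- the global Hecke integrals `Z`, `Z'` -/
  obtain ⟨Z, hZ⟩ : ∃ Z : ℂ → ℂ, Z = fun s => k₀⁻¹ * jpssIntegral Nat.one_lt_two μ₁ φ (fun _ => 1) s :=
    ⟨_, rfl⟩
  obtain ⟨Z', hZ'⟩ : ∃ Z' : ℂ → ℂ,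
      Z' = fun s => k₀⁻¹ * jpssIntegral Nat.one_lt_two μ₁ (φ ∘ glTransposeInvQuot 2 K) (fun _ => 1) s :=
    ⟨_, rfl⟩
  have hφc : Continuous φ := continuous_of_continuous_invQuot hφ.1.continuous_gl
  have hφd : IsRapidlyDecreasingGL 2 K (invQuot (AdelicGroupData.gl 2 K) φ) :=
    hφ.isRapidlyDecreasingGL_of_center' fun z hz g => invQuot_mul_left _ φ (Subgroup.mem_sup_left hz) g
  have h1c : Continuous (fun _ : (AdelicGroupData.gl 1 K).automorphicQuotient => (1 : ℂ)) := continuous_const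
  have h1d : IsRapidlyDecreasingGL 1 K (invQuot (AdelicGroupData.gl 1 K)
      (fun _ : (AdelicGroupData.gl 1 K).automorphicQuotient => (1 : ℂ))) :=
    isRapidlyDecreasingGL_of_fin_one _
  have hcl : invQuot (AdelicGroupData.gl 2 K) (φ ∘ glTransposeInvQuot 2 K) =
      invQuot (AdelicGroupData.gl 2 K) φ ∘ GLn.transposeInv 2 K :=
    funext fun g => invQuot_comp_glTransposeInvQuot φ g
  have hφι : IsCuspFormGL 2 K hcpt (invQuot (AdelicGroupData.gl 2 K) (φ ∘ glTransposeInvQuot 2 K)) := by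
    rw [hcl]; exact hφ.comp_transposeInv
  have hφιc : Continuous (φ ∘ glTransposeInvQuot 2 K) := continuous_of_continuous_invQuot hφι.1.continuous_gl
  have hφιd : IsRapidlyDecreasingGL 2 K (invQuot (AdelicGroupData.gl 2 K) (φ ∘ glTransposeInvQuot 2 K)) :=
    hφι.isRapidlyDecreasingGL_of_center' fun z hz g => invQuot_mul_left _ _ (Subgroup.mem_sup_left hz) g
  have hZd : Differentiable ℂ Z := by
    rw [hZ]
    exact (differentiable_jpssIntegral (μ' := μ₁) Nat.one_pos Nat.one_lt_two hφc hφd h1c h1d).const_mul _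
  have hZ'd : Differentiable ℂ Z' := by
    rw [hZ']
    exact (differentiable_jpssIntegral (μ' := μ₁) Nat.one_pos Nat.one_lt_two hφιc hφιd h1c h1d).const_mul _
  have hFE : ∀ s, Z s = Z' (1 - s) := fun s => by
    rw [hZ, hZ']
    simp only
    rw [jpssIntegral_eq_jpssIntegral_comp_glTransposeInvQuot_one_sub Nat.one_lt_two μ₁ φ (fun _ => 1) s]
    rfl
  /- local absolute convergence at every place for the vectors `x_v` (direct and dual) -/
  have hψv : ∀ u : HeightOneSpectrum (𝓞 K), ((adeleAddChar K).adicComponent u).IsContinuousNontrivial :=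
    fun u => (isGlobalAddChar_adeleAddChar K).isContinuousNontrivial_adicComponent
      (adicComponent_adeleAddChar_ne_one u)
  have hP2 : ∀ v : HeightOneSpectrum (𝓞 K), ∃ cv : ℝ, ∀ s : ℂ, cv < s.re →
      Integrable (fun y : (v.adicCompletion K)ˣ => lam v (ρ v (diagGL2 y 1) (x v)) *
        (((normAbs (v.adicCompletion K) (y : v.adicCompletion K) : ℝ≥0) : ℝ) : ℂ) ^ (s - 1 / 2)) (μv v) ∧
      Integrable (fun y : (v.adicCompletion K)ˣ => tildeFn (whittakerModel (ρ v) (lam v) (x v)) (diagGL2 y 1) *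
        (((normAbs (v.adicCompletion K) (y : v.adicCompletion K) : ℝ≥0) : ℝ) : ℂ) ^ (s - 1 / 2)) (μv v) :=
    fun v => exists_forall_integrable_heckeIntegrand_and_dual (ρ v) (hρ v).1 (hρ v).2.isSmooth (hψv v)
      (hlamW v) (μv v) (x v)
  choose cv hcv using hP2
  /- uniform constants: the geometric bound and uniformizers -/
  obtain ⟨Cb, hCb0, hCb⟩ := tsum_sq_mul_pow_le
  have hϖex : ∀ u : HeightOneSpectrum (𝓞 K), ∃ ϖ : (u.adicCompletion K)ˣ,
      (ValuativeRel.valuation (u.adicCompletion K)).IsUniformizer (ϖ : u.adicCompletion K) := fun u => by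
    obtain ⟨ϖ, hϖ⟩ := Valuation.exists_isUniformizer_of_isCyclic_of_nontrivial
      (ValuativeRel.valuation (u.adicCompletion K))
    exact ⟨Units.mk0 _ hϖ.ne_zero, hϖ⟩
  choose ϖ hϖ using hϖex
  /- the good places: Satake data transported to the Flath factors -/
  have hgood : ∀ v, v ∉ S → ∃ xv : Fin 2 → ℂ, (Finset.univ : Finset (Fin 2)).val.map xv = αf v ∧
      (∀ i, xv i ≠ 0) ∧ (∀ a ∈ αf v, ‖a‖ ≤ Real.sqrt v.residueCard) ∧
      (∀ a ∈ αf v, ‖a⁻¹‖ ≤ Real.sqrt v.residueCard) ∧ ‖(αf v).esymm 2‖ = 1 ∧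
      (∀ r, 1 ≤ r → r ≤ 2 → heckeT (ρ v) (ϖ v) r (x₀ v) =
        ((((Real.sqrt (residueFieldCard (v.adicCompletion K))) ^ (r * (2 - r)) : ℝ) : ℂ) *
          (αf v).esymm r) • x₀ v) := by
    intro v hv
    obtain ⟨xv, hxv, hxv0, hbd, hbd', he1⟩ := exists_enum_satakeParameter_two Pl hαf (hsat v hv)
    exact ⟨xv, hxv, hxv0, hbd, hbd', he1, heckeT_eq_smul_of_isSatakeFamilyOf_of_hasLocalComponentAt Pl hαf
      (hsat v hv) (hρ v).1 (hloc v) (hfix v hv) (hϖ v)⟩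
  /- the abscissa -/
  obtain ⟨c, hcdef⟩ : ∃ c : ℝ, c = max (max x₁ 2) (∑ v ∈ S, |cv v|) := ⟨_, rfl⟩
  have hx₁c : ∀ {s : ℂ}, c < s.re → x₁ < s.re := fun hs =>
    lt_of_le_of_lt ((le_max_left _ _).trans ((le_max_left _ _).trans (le_of_eq hcdef.symm))) hs
  have h2c : ∀ {s : ℂ}, c < s.re → 2 < s.re := fun hs =>
    lt_of_le_of_lt ((le_max_right _ _).trans ((le_max_left _ _).trans (le_of_eq hcdef.symm))) hs
  have hcvc : ∀ {s : ℂ}, c < s.re → ∀ v ∈ S, cv v < s.re := fun hs v hv =>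
    lt_of_le_of_lt (((le_abs_self _).trans (Finset.single_le_sum (fun w _ => abs_nonneg (cv w)) hv)).trans
      ((le_max_right _ _).trans (le_of_eq hcdef.symm))) hs
  /- continuity of the global integrands (for measurability) -/
  have hΦc : Continuous (invQuot (AdelicGroupData.gl 2 K) φ) := hφ.1.continuous_gl
  have hFc : ∀ s : ℂ, Continuous fun a : ideleGroup K =>
      whittakerDepth 0 (invQuot (AdelicGroupData.gl 2 K) φ) (glDiagonal 2 (AdeleRing (𝓞 K) K) ![a, 1]) *
        ((IdeleClassGroup.ideleNorm K a : ℝ) : ℂ) ^ (s - 1 / 2) := fun s =>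
    continuous_heckeIntegrand_of_continuous hΦc (s - 1 / 2)
  have hFc' : ∀ s : ℂ, Continuous fun a : ideleGroup K =>
      tildeFn (whittakerDepth 0 (invQuot (AdelicGroupData.gl 2 K) φ)) (glDiagonal 2 (AdeleRing (𝓞 K) K) ![a, 1]) *
        ((IdeleClassGroup.ideleNorm K a : ℝ) : ℂ) ^ (s - 1 / 2) := fun s =>
    continuous_dualHeckeIntegrand_of_continuous hΦc (s - 1 / 2)
  /- the local zeta integrals at `u ∈ S` in torus form -/
  have hrs : ∀ u ∈ S, ∀ s : ℂ, rsZeta Nat.one_lt_two (νq u) (whittakerModel (ρ u) (lam u) (t u)) (fun _ => 1) s =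
      ∫ y : (u.adicCompletion K)ˣ, lam u (ρ u (diagGL2 y 1) (x u)) *
        (((normAbs (u.adicCompletion K) (y : u.adicCompletion K) : ℝ≥0) : ℝ) : ℂ) ^ (s - 1 / 2) ∂(μv u) := by
    intro u hu s
    rw [rsZeta_eq_integral_torus (μv u) (νq u) (hνint u) (whittakerModel (ρ u) (lam u) (t u))
      (W' := fun _ => (1 : ℂ)) (κ := 1) (fun _ => rfl) s, hxS' u hu]
    refine integral_congr_ae (Eventually.of_forall fun y => ?_)
    simp only [whittakerModel_apply, mul_one]
  have hrs' : ∀ u ∈ S, ∀ s : ℂ,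
      rsZeta Nat.one_lt_two (νq u) (tildeFn (whittakerModel (ρ u) (lam u) (t u))) (fun _ => 1) s =
      ∫ y : (u.adicCompletion K)ˣ, tildeFn (whittakerModel (ρ u) (lam u) (x u)) (diagGL2 y 1) *
        (((normAbs (u.adicCompletion K) (y : u.adicCompletion K) : ℝ≥0) : ℝ) : ℂ) ^ (s - 1 / 2) ∂(μv u) := by
    intro u hu s
    rw [rsZeta_eq_integral_torus (μv u) (νq u) (hνint u) (tildeFn (whittakerModel (ρ u) (lam u) (t u)))
      (W' := fun _ => (1 : ℂ)) (κ := 1) (fun _ => rfl) s, hxS' u hu]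
    refine integral_congr_ae (Eventually.of_forall fun y => ?_)
    simp only [mul_one]
  /- the two Euler factorisations on `re s > c` -/
  have key : ∀ s : ℂ, c < s.re →
      (Z s = (∫ u : (mixedSpace K)ˣ, kirillovFn hτc (transferMap ℓ hτc T₀) e₀ u *
          ((mixedEmbedding.norm ((u : (mixedSpace K)ˣ) : mixedSpace K) : ℝ) : ℂ) ^ (s - 1 / 2) ∂μi) *
        (∏ u ∈ S, ∫ y : (u.adicCompletion K)ˣ, lam u (ρ u (diagGL2 y 1) (x u)) *
          (((normAbs (u.adicCompletion K) (y : u.adicCompletion K) : ℝ≥0) : ℝ) : ℂ) ^ (s - 1 / 2) ∂(μv u)) *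
        partialStandardL (S : Set (HeightOneSpectrum (𝓞 K))) αf s) ∧
      (Z' s = (∫ u : (mixedSpace K)ˣ, tildeFn (fun g : GL (Fin 2) (mixedSpace K) =>
            transferMap ℓ hτc T₀ ⟨τ (toArch hcpt g) (e₀ : E), apply_mem_archGardingSpace hτc _ e₀.2⟩) (diagGL2 u 1) *
          ((mixedEmbedding.norm ((u : (mixedSpace K)ˣ) : mixedSpace K) : ℝ) : ℂ) ^ (s - 1 / 2) ∂μi) *
        (∏ u ∈ S, ∫ y : (u.adicCompletion K)ˣ, tildeFn (whittakerModel (ρ u) (lam u) (x u)) (diagGL2 y 1) *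
          (((normAbs (u.adicCompletion K) (y : u.adicCompletion K) : ℝ≥0) : ℝ) : ℂ) ^ (s - 1 / 2) ∂(μv u)) *
        partialStandardL (S : Set (HeightOneSpectrum (𝓞 K))) (dualFamily αf) s) := by
    intro s hs
    have hs12 : 1 / 2 < s.re := by linarith [h2c hs]
    have hs1 : 1 < s.re := by linarith [h2c hs]
    have hs32 : 3 / 2 ≤ s.re := by linarith [h2c hs]
    have hs32' : 3 / 2 < s.re := by linarith [h2c hs]
    have hsum : 1 < s.re - 1 / 2 := by linarith [h2c hs]
    -- the unit spheres
    -- the good local factors, direct and dual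
    have hunr : ∀ w : {v : HeightOneSpectrum (𝓞 K) // v ∉ S},
        Integrable (fun y : (w.1.adicCompletion K)ˣ => lam w.1 (ρ w.1 (diagGL2 y 1) (x₀ w.1)) *
          (((normAbs (w.1.adicCompletion K) (y : w.1.adicCompletion K) : ℝ≥0) : ℝ) : ℂ) ^ (s - 1 / 2)) (μv w.1) ∧
        ∫ y : (w.1.adicCompletion K)ˣ, lam w.1 (ρ w.1 (diagGL2 y 1) (x₀ w.1)) *
            (((normAbs (w.1.adicCompletion K) (y : w.1.adicCompletion K) : ℝ≥0) : ℝ) : ℂ) ^ (s - 1 / 2) ∂(μv w.1) =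
          ((μv w.1 {y : (w.1.adicCompletion K)ˣ | Valued.v (y : w.1.adicCompletion K) = 1}).toReal : ℂ) *
            lam w.1 (x₀ w.1) * ((eulerPolynomial (αf w.1)).eval ((w.1.residueCard : ℂ) ^ (-s)))⁻¹ := by
      intro w
      obtain ⟨xv, hxv, -, hbd, -, -, hT⟩ := hgood w.1 w.2
      exact integrable_and_integral_heckeIntegrand_spherical (ρ w.1) (hϖ w.1) (hψ0 w.1 w.2) (hlamW w.1)
        (hfix w.1 w.2) hxv hT hbd (μv w.1) hs12
    have hunrd : ∀ w : {v : HeightOneSpectrum (𝓞 K) // v ∉ S},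
        Integrable (fun y : (w.1.adicCompletion K)ˣ => tildeFn (whittakerModel (ρ w.1) (lam w.1) (x₀ w.1)) (diagGL2 y 1) *
          (((normAbs (w.1.adicCompletion K) (y : w.1.adicCompletion K) : ℝ≥0) : ℝ) : ℂ) ^ (s - 1 / 2)) (μv w.1) ∧
        ∫ y : (w.1.adicCompletion K)ˣ, tildeFn (whittakerModel (ρ w.1) (lam w.1) (x₀ w.1)) (diagGL2 y 1) *
            (((normAbs (w.1.adicCompletion K) (y : w.1.adicCompletion K) : ℝ≥0) : ℝ) : ℂ) ^ (s - 1 / 2) ∂(μv w.1) =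
          ((μv w.1 {y : (w.1.adicCompletion K)ˣ | Valued.v (y : w.1.adicCompletion K) = 1}).toReal : ℂ) *
            lam w.1 (x₀ w.1) * ((eulerPolynomial (dualFamily αf w.1)).eval ((w.1.residueCard : ℂ) ^ (-s)))⁻¹ := by
      intro w
      obtain ⟨xv, hxv, hxv0, -, hbd', -, hT⟩ := hgood w.1 w.2
      exact integrable_and_integral_dualHeckeIntegrand_spherical (ρ w.1) (hϖ w.1) (hψ0 w.1 w.2) (hlamW w.1)
        (hfix w.1 w.2) hxv hxv0 hT hbd' (μv w.1) hs12
    -- local integrability at every place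
    have hhi : ∀ v : HeightOneSpectrum (𝓞 K), Integrable (fun y : (v.adicCompletion K)ˣ =>
        lam v (ρ v (diagGL2 y 1) (x v)) *
          (((normAbs (v.adicCompletion K) (y : v.adicCompletion K) : ℝ≥0) : ℝ) : ℂ) ^ (s - 1 / 2)) (μv v) := by
      intro v
      by_cases hv : v ∈ S
      · exact (hcv v s (hcvc hs v hv)).1
      · have h := (hunr ⟨v, hv⟩).1
        simp only [hxS v hv]
        exact h
    have hhid : ∀ v : HeightOneSpectrum (𝓞 K), Integrable (fun y : (v.adicCompletion K)ˣ =>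
        tildeFn (whittakerModel (ρ v) (lam v) (x v)) (diagGL2 y 1) *
          (((normAbs (v.adicCompletion K) (y : v.adicCompletion K) : ℝ≥0) : ℝ) : ℂ) ^ (s - 1 / 2)) (μv v) := by
      intro v
      by_cases hv : v ∈ S
      · exact (hcv v s (hcvc hs v hv)).2
      · have h := (hunrd ⟨v, hv⟩).1
        simp only [hxS v hv]
        exact h
    -- the uniform absolute bounds off `S`
    have hbd : ∀ w ∉ S, ∫ y : (w.adicCompletion K)ˣ, ‖lam w (ρ w (diagGL2 y 1) (x₀ w)) *
          (((normAbs (w.adicCompletion K) (y : w.adicCompletion K) : ℝ≥0) : ℝ) : ℂ) ^ (s - 1 / 2)‖ ∂(μv w) ≤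
        (μv w {y : (w.adicCompletion K)ˣ | Valued.v (y : w.adicCompletion K) = 1}).toReal * ‖lam w (x₀ w)‖ *
          (1 + Cb * (w.residueCard : ℝ) ^ (-(s.re - 1 / 2))) := by
      intro w hw
      obtain ⟨xv, hxv, -, hbd, -, he1, hT⟩ := hgood w hw
      have h := (integral_norm_heckeIntegrand_spherical_le (ρ w) (hϖ w) (hψ0 w hw) (hlamW w) (hfix w hw) hxv hT
        hbd he1 (μv w) hCb hs32).1
      rwa [neg_sub]
    have hbdd : ∀ w ∉ S, ∫ y : (w.adicCompletion K)ˣ, ‖tildeFn (whittakerModel (ρ w) (lam w) (x₀ w)) (diagGL2 y 1) *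
          (((normAbs (w.adicCompletion K) (y : w.adicCompletion K) : ℝ≥0) : ℝ) : ℂ) ^ (s - 1 / 2)‖ ∂(μv w) ≤
        (μv w {y : (w.adicCompletion K)ˣ | Valued.v (y : w.adicCompletion K) = 1}).toReal * ‖lam w (x₀ w)‖ *
          (1 + Cb * (w.residueCard : ℝ) ^ (-(s.re - 1 / 2))) := by
      intro w hw
      obtain ⟨xv, hxv, -, hbd, -, he1, hT⟩ := hgood w hw
      have h := (integral_norm_heckeIntegrand_spherical_le (ρ w) (hϖ w) (hψ0 w hw) (hlamW w) (hfix w hw) hxv hT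
        hbd he1 (μv w) hCb hs32).2
      rwa [neg_sub]
    have ha0 : ∀ w : HeightOneSpectrum (𝓞 K), 0 ≤ Cb * (w.residueCard : ℝ) ^ (-(s.re - 1 / 2)) := fun w =>
      mul_nonneg hCb0 (Real.rpow_nonneg (Nat.cast_nonneg _) _)
    have ha : Summable fun w : HeightOneSpectrum (𝓞 K) => Cb * (w.residueCard : ℝ) ^ (-(s.re - 1 / 2)) :=
      (summable_residueCard_rpow_neg hsum).mul_left Cb
    -- the Euler products of the good factors
    have hL : HasProd (fun w : {v : HeightOneSpectrum (𝓞 K) // v ∉ S} =>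
        ((eulerPolynomial (αf w.1)).eval ((w.1.residueCard : ℂ) ^ (-s)))⁻¹)
        (partialStandardL (S : Set (HeightOneSpectrum (𝓞 K))) αf s) :=
      (multipliable_partialStandardL_holds Pl hαfS hs1).hasProd
    have hLd : HasProd (fun w : {v : HeightOneSpectrum (𝓞 K) // v ∉ S} =>
        ((eulerPolynomial (dualFamily αf w.1)).eval ((w.1.residueCard : ℂ) ^ (-s)))⁻¹)
        (partialStandardL (S : Set (HeightOneSpectrum (𝓞 K))) (dualFamily αf) s) :=
      (multipliable_partialEuler_dualFamily_of_lt_re Pl hαfS hs32').hasProd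
    -- absolute convergence of the unfolded global integrals (p. 172)
    have hint : Integrable (fun a : ideleGroup K =>
        whittakerDepth 0 (invQuot (AdelicGroupData.gl 2 K) φ) (glDiagonal 2 (AdeleRing (𝓞 K) K) ![a, 1]) *
          ((IdeleClassGroup.ideleNorm K a : ℝ) : ℂ) ^ (s - 1 / 2)) νI := by
      rw [hφdef]
      exact integrable_heckeIntegrand_pureTensor Pl hτc ν₀ hΛ hprod hslot hlam1 S x e₀ hxS hfix νI μi μv
        (s - 1 / 2) (hI s (hx₁c hs)).1 hhi ha0 ha hbd (by rw [← hφdef]; exact (hFc s).aestronglyMeasurable)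
    have hintd : Integrable (fun a : ideleGroup K =>
        tildeFn (whittakerDepth 0 (invQuot (AdelicGroupData.gl 2 K) φ)) (glDiagonal 2 (AdeleRing (𝓞 K) K) ![a, 1]) *
          ((IdeleClassGroup.ideleNorm K a : ℝ) : ℂ) ^ (s - 1 / 2)) νI := by
      rw [hφdef]
      exact integrable_dualHeckeIntegrand_pureTensor Pl hτc ν₀ hΛ hprod hslot hlam1 S x e₀ hxS hfix νI μi μv
        (s - 1 / 2) (hI s (hx₁c hs)).2 hhid ha0 ha hbdd (by rw [← hφdef]; exact (hFc' s).aestronglyMeasurable)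
    -- the Euler factorisations of the unfolded integrals ((11.1.2))
    have hEul : ∫ a : ideleGroup K,
        whittakerDepth 0 (invQuot (AdelicGroupData.gl 2 K) φ) (glDiagonal 2 (AdeleRing (𝓞 K) K) ![a, 1]) *
          ((IdeleClassGroup.ideleNorm K a : ℝ) : ℂ) ^ (s - 1 / 2) ∂νI =
        (cS : ℂ) * Λ₀ (j (RestrictedFamily.extend S fun v : ↥S => eu v)) *
          (∫ u : (mixedSpace K)ˣ, kirillovFn hτc (transferMap ℓ hτc T₀) e₀ u *
            ((mixedEmbedding.norm ((u : (mixedSpace K)ˣ) : mixedSpace K) : ℝ) : ℂ) ^ (s - 1 / 2) ∂μi) *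
          (∏ u ∈ S, ∫ y : (u.adicCompletion K)ˣ, lam u (ρ u (diagGL2 y 1) (x u)) *
            (((normAbs (u.adicCompletion K) (y : u.adicCompletion K) : ℝ≥0) : ℝ) : ℂ) ^ (s - 1 / 2) ∂(μv u)) *
          partialStandardL (S : Set (HeightOneSpectrum (𝓞 K))) αf s := by
      have h := integral_heckeIntegrand_pureTensor_eq_mul_tprod Pl hτc ν₀ hΛ hprod hslot hlam1 S x e₀ hxS hfix
        νI μi μv hcS (s - 1 / 2) _ hL hunr (hI s (hx₁c hs)).1 (fun v _ => hhi v) (by rw [← hφdef]; exact hint)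
      rw [hφdef]
      exact h
    have hEuld : ∫ a : ideleGroup K,
        tildeFn (whittakerDepth 0 (invQuot (AdelicGroupData.gl 2 K) φ)) (glDiagonal 2 (AdeleRing (𝓞 K) K) ![a, 1]) *
          ((IdeleClassGroup.ideleNorm K a : ℝ) : ℂ) ^ (s - 1 / 2) ∂νI =
        (cS : ℂ) * Λ₀ (j (RestrictedFamily.extend S fun v : ↥S => eu v)) *
          (∫ u : (mixedSpace K)ˣ, tildeFn (fun g : GL (Fin 2) (mixedSpace K) =>
              transferMap ℓ hτc T₀ ⟨τ (toArch hcpt g) (e₀ : E), apply_mem_archGardingSpace hτc _ e₀.2⟩) (diagGL2 u 1) *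
            ((mixedEmbedding.norm ((u : (mixedSpace K)ˣ) : mixedSpace K) : ℝ) : ℂ) ^ (s - 1 / 2) ∂μi) *
          (∏ u ∈ S, ∫ y : (u.adicCompletion K)ˣ, tildeFn (whittakerModel (ρ u) (lam u) (x u)) (diagGL2 y 1) *
            (((normAbs (u.adicCompletion K) (y : u.adicCompletion K) : ℝ≥0) : ℝ) : ℂ) ^ (s - 1 / 2) ∂(μv u)) *
          partialStandardL (S : Set (HeightOneSpectrum (𝓞 K))) (dualFamily αf) s := by
      have h := integral_dualHeckeIntegrand_pureTensor_eq_mul_tprod Pl hτc ν₀ hΛ hprod hslot hlam1 S x e₀ hxS hfix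
        νI μi μv hcS (s - 1 / 2) _ hLd hunrd (hI s (hx₁c hs)).2 (fun v _ => hhid v) (by rw [← hφdef]; exact hintd)
      rw [hφdef]
      exact h
    -- the unfolding of the global Hecke integrals (p. 171) with the constant `C`
    have hunf₁ := (hunf φ hφ s).1
    have hunf₂ := (hunf φ hφ s).2
    rw [← hνIdef] at hunf₁ hunf₂
    have hZs : Z s = k₀⁻¹ * ((C : ℂ) * ∫ a : ideleGroup K,
        whittakerDepth 0 (invQuot (AdelicGroupData.gl 2 K) φ) (glDiagonal 2 (AdeleRing (𝓞 K) K) ![a, 1]) *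
          ((IdeleClassGroup.ideleNorm K a : ℝ) : ℂ) ^ (s - 1 / 2) ∂νI) := by
      rw [hZ]
      simp only
      rw [hunf₁ hint.2]
    have hZ's : Z' s = k₀⁻¹ * ((C : ℂ) * ∫ a : ideleGroup K,
        tildeFn (whittakerDepth 0 (invQuot (AdelicGroupData.gl 2 K) φ)) (glDiagonal 2 (AdeleRing (𝓞 K) K) ![a, 1]) *
          ((IdeleClassGroup.ideleNorm K a : ℝ) : ℂ) ^ (s - 1 / 2) ∂νI) := by
      rw [hZ']
      simp only
      rw [hunf₂ hintd.2]
    refine ⟨?_, ?_⟩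
    · rw [hZs, hEul, hk₀]
      field_simp
    · rw [hZ's, hEuld, hk₀]
      field_simp
  refine ⟨Z, Z', c, hZd, hZ'd, hFE, fun s hs => ?_, fun s hs => ?_⟩
  · rw [(key s hs).1, Finset.prod_congr rfl fun u hu => hrs u hu s]
  · rw [(key s hs).2, Finset.prod_congr rfl fun u hu => hrs' u hu s]

/-- **`(E′)` verbatim** — the hypothesis `hE` of
`integralRepresentation_clean_of_archHeckeTestVector_of_heckeEulerFactorisation'`
(`StandardLTheoryGL2OfArchTestVectorAndEulerFactorisationIntegrable`): `heckeEulerFactorisationGL2'` with the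
record that `τ` occurs in `Π` dropped. [cite: JacquetLanglands1970, (11.1.2) p. 171, p. 172, Lemma 11.1.3] -/
theorem heckeEulerFactorisationGL2 {K : Type} [Field K] [NumberField K]
    (hcpt : isCompact_glFiniteIntegralLevel 2 K)
    (μ : Measure (AdelicGroupData.gl 2 K).automorphicQuotient) [(AdelicGroupData.gl 2 K).IsAutomorphicMeasure μ]
    (Pl : CuspidalAutomorphicRepGL 2 K μ)
    [MeasurableSpace ((mixedSpace K)ˣ)] [BorelSpace ((mixedSpace K)ˣ)]
    [∀ u : HeightOneSpectrum (𝓞 K), MeasurableSpace (u.adicCompletion K)]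
    [∀ u : HeightOneSpectrum (𝓞 K), BorelSpace (u.adicCompletion K)]
    [∀ u : HeightOneSpectrum (𝓞 K),
      MeasurableSpace (GL (Fin 1) (u.adicCompletion K) ⧸ upperUnitriangular (Fin 1) (u.adicCompletion K))]
    [∀ u : HeightOneSpectrum (𝓞 K),
      BorelSpace (GL (Fin 1) (u.adicCompletion K) ⧸ upperUnitriangular (Fin 1) (u.adicCompletion K))] :
    ∃ (S₀ : Finset (HeightOneSpectrum (𝓞 K))) (αf : SatakeFamily K)
      (_ : IsSatakeFamilyOf Pl (S₀ : Set (HeightOneSpectrum (𝓞 K))) αf)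
      (E : Type) (_ : NormedAddCommGroup E) (_ : InnerProductSpace ℂ E) (_ : CompleteSpace E)
      (τ : ContRepresentation ℂ (AutomorphyDatum.gl 2 K hcpt).arch.carrier E) (hτ : τ.IsStronglyContinuous)
      (_ : τ.IsUnitary) (_ : τ.IsTopIrreducible)
      (ℓ : archGardingSpace hcpt τ →ₗ[ℂ] ℂ) (_ : IsArchContWhittakerFunctional hcpt τ hτ ℓ) (_ : ℓ ≠ 0)
      (μi : Measure ((mixedSpace K)ˣ)) (_ : IsHaarMeasure μi)
      (Vl : HeightOneSpectrum (𝓞 K) → Type) (_ : ∀ u, AddCommGroup (Vl u)) (_ : ∀ u, Module ℂ (Vl u))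
      (ρ : ∀ u : HeightOneSpectrum (𝓞 K), Representation ℂ (GL (Fin 2) (u.adicCompletion K)) (Vl u))
      (_ : ∀ u, (ρ u).IsIrreducible) (_ : ∀ u, (ρ u).IsSmooth)
      (_ : ∀ u, Automorphic.HasLocalComponentAt Pl.1 u (ρ u))
      (Λ : ∀ u, Module.Dual ℂ (Vl u))
      (_ : ∀ u, Λ u ∈ whittakerFunctionals (ρ u) ((adeleAddChar K).adicComponent u)) (_ : ∀ u, Λ u ≠ 0)
      (ν : ∀ u : HeightOneSpectrum (𝓞 K),
        Measure (GL (Fin 1) (u.adicCompletion K) ⧸ upperUnitriangular (Fin 1) (u.adicCompletion K)))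
      (_ : ∀ u, SMulInvariantMeasure (GL (Fin 1) (u.adicCompletion K))
        (GL (Fin 1) (u.adicCompletion K) ⧸ upperUnitriangular (Fin 1) (u.adicCompletion K)) (ν u))
      (_ : ∀ u, IsFiniteMeasureOnCompacts (ν u)) (_ : ∀ u, (ν u).IsOpenPosMeasure),
      ∀ (S : Finset (HeightOneSpectrum (𝓞 K))), S₀ ⊆ S →
      ∀ (t : ∀ u, Vl u) (e₀ : archGardingSpace hcpt τ),
        FiniteDimensional ℂ (Submodule.span ℂ (Set.range
          fun κ : (AutomorphyDatum.gl 2 K hcpt).arch.maximalCompact =>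
            τ (toArch hcpt (κ : GL (Fin 2) (mixedSpace K))) (e₀ : E))) →
      ∀ x₁ : ℝ, (∀ s : ℂ, x₁ < s.re →
          Integrable (fun u : (mixedSpace K)ˣ => kirillovFn hτ ℓ e₀ u *
            ((mixedEmbedding.norm ((u : (mixedSpace K)ˣ) : mixedSpace K) : ℝ) : ℂ) ^ (s - 1 / 2)) μi ∧
          Integrable (fun u : (mixedSpace K)ˣ =>
            tildeFn (fun g : GL (Fin 2) (mixedSpace K) =>
                ℓ ⟨τ (toArch hcpt g) (e₀ : E), apply_mem_archGardingSpace hτ _ e₀.2⟩) (diagGL2 u 1) *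
              ((mixedEmbedding.norm ((u : (mixedSpace K)ˣ) : mixedSpace K) : ℝ) : ℂ) ^ (s - 1 / 2)) μi) →
        ∃ (Z Z' : ℂ → ℂ) (c : ℝ), Differentiable ℂ Z ∧ Differentiable ℂ Z' ∧ (∀ s, Z s = Z' (1 - s)) ∧
          (∀ s : ℂ, c < s.re → Z s =
            (∫ u : (mixedSpace K)ˣ, kirillovFn hτ ℓ e₀ u *
                ((mixedEmbedding.norm ((u : (mixedSpace K)ˣ) : mixedSpace K) : ℝ) : ℂ) ^ (s - 1 / 2) ∂μi) *
              (∏ u ∈ S, rsZeta Nat.one_lt_two (ν u) (whittakerModel (ρ u) (Λ u) (t u)) (fun _ => 1) s) *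
              partialStandardL (S : Set (HeightOneSpectrum (𝓞 K))) αf s) ∧
          (∀ s : ℂ, c < s.re → Z' s =
            (∫ u : (mixedSpace K)ˣ,
                tildeFn (fun g : GL (Fin 2) (mixedSpace K) =>
                    ℓ ⟨τ (toArch hcpt g) (e₀ : E), apply_mem_archGardingSpace hτ _ e₀.2⟩) (diagGL2 u 1) *
                  ((mixedEmbedding.norm ((u : (mixedSpace K)ˣ) : mixedSpace K) : ℝ) : ℂ) ^ (s - 1 / 2) ∂μi) *
              (∏ u ∈ S, rsZeta Nat.one_lt_two (ν u) (tildeFn (whittakerModel (ρ u) (Λ u) (t u)))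
                (fun _ => 1) s) *
              partialStandardL (S : Set (HeightOneSpectrum (𝓞 K))) (dualFamily αf) s) := by
  obtain ⟨S₀, αf, hαf, E, i₁, i₂, i₃, τ, hτ, hτu, hτi, -, rest⟩ := heckeEulerFactorisationGL2' hcpt μ Pl
  exact ⟨S₀, αf, hαf, E, i₁, i₂, i₃, τ, hτ, hτu, hτi, rest⟩

end Main

/-! ### 3. The standard `L`-theory of `GL₂` and Gelbart's Prop. 4.1 from the archimedean test vector alone -/

section Corollaries

/-- **Jacquet–Langlands (1970), Thm. 11.1 with Cor. 11.2 for `GL₂` over a number field, from the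
archimedean test vector `(A∞)` ALONE.** With `(E′)` proved (`heckeEulerFactorisationGL2`), the named fact
`JacquetLanglands1970_standardLTheoryGL2` — the standard `L`-function theory of the cuspidal automorphic
representations of `GL₂` (honest local Euler factors at all finite places, entire continuation, functional
equation, unramified computation, vanishing under ramified twists, rigidity) — follows from the archimedean
input of p. 173 of the printed proof: Thm. 5.15 (ii)(iii) (real places) / Thm. 6.4 (complex places), in the
form `(A∞)` of `StandardLTheoryGL2OfArchTestVectorAndEulerFactorisation` (one `K_∞`-finite Gårding vector
`e₀` whose two archimedean Hecke integrals converge absolutely on a right half-plane and equal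
`A e^{αs} ∏ Γ_ℝ(s + a_j) ∏ Γ_ℂ(s + b_j)` there; the statement of the named fact
`JacquetLanglands1970_archHeckeTestVectorGL2` requested for the tree).
[cite: JacquetLanglands1970, Thm. 11.1, Cor. 11.2, Thm. 5.15, Thm. 6.4, proof of Thm. 11.1 (pp. 171–173)] -/
theorem JacquetLanglands1970_standardLTheoryGL2_of_archHeckeTestVector
    (hA : ∀ (K : Type) [Field K] [NumberField K] (hcpt : isCompact_glFiniteIntegralLevel 2 K)
      (E : Type) [NormedAddCommGroup E] [InnerProductSpace ℂ E] [CompleteSpace E]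
      (τ : ContRepresentation ℂ (AutomorphyDatum.gl 2 K hcpt).arch.carrier E) (hτ : τ.IsStronglyContinuous)
      (_ : τ.IsUnitary) (_ : τ.IsTopIrreducible)
      (ℓ : archGardingSpace hcpt τ →ₗ[ℂ] ℂ) (_ : IsArchContWhittakerFunctional hcpt τ hτ ℓ) (_ : ℓ ≠ 0)
      [MeasurableSpace ((mixedSpace K)ˣ)] [BorelSpace ((mixedSpace K)ˣ)]
      (μ : Measure ((mixedSpace K)ˣ)) (_ : IsHaarMeasure μ),
      ∃ (e₀ : archGardingSpace hcpt τ)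
        (_ : FiniteDimensional ℂ (Submodule.span ℂ (Set.range
          fun κ : (AutomorphyDatum.gl 2 K hcpt).arch.maximalCompact =>
            τ (toArch hcpt (κ : GL (Fin 2) (mixedSpace K))) (e₀ : E))))
        (d₁ d₂ d₁' d₂' : ℕ) (a : Fin d₁ → ℂ) (b : Fin d₂ → ℂ) (a' : Fin d₁' → ℂ) (b' : Fin d₂' → ℂ)
        (A A' : ℂ) (_ : A ≠ 0) (_ : A' ≠ 0) (α α' : ℂ) (x₀ : ℝ),
        (∀ s : ℂ, x₀ < s.re →
          Integrable (fun u : (mixedSpace K)ˣ =>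
            kirillovFn hτ ℓ e₀ u *
              ((mixedEmbedding.norm ((u : (mixedSpace K)ˣ) : mixedSpace K) : ℝ) : ℂ) ^ (s - 1 / 2)) μ ∧
          ∫ u : (mixedSpace K)ˣ, kirillovFn hτ ℓ e₀ u *
              ((mixedEmbedding.norm ((u : (mixedSpace K)ˣ) : mixedSpace K) : ℝ) : ℂ) ^ (s - 1 / 2) ∂μ =
            A * Complex.exp (α * s) *
              ((∏ j, Complex.Gammaℝ (s + a j)) * ∏ j, Complex.Gammaℂ (s + b j))) ∧
        (∀ s : ℂ, x₀ < s.re →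
          Integrable (fun u : (mixedSpace K)ˣ =>
            tildeFn (fun g : GL (Fin 2) (mixedSpace K) =>
                ℓ ⟨τ (toArch hcpt g) (e₀ : E), apply_mem_archGardingSpace hτ _ e₀.2⟩) (diagGL2 u 1) *
              ((mixedEmbedding.norm ((u : (mixedSpace K)ˣ) : mixedSpace K) : ℝ) : ℂ) ^ (s - 1 / 2)) μ ∧
          ∫ u : (mixedSpace K)ˣ,
              tildeFn (fun g : GL (Fin 2) (mixedSpace K) =>
                  ℓ ⟨τ (toArch hcpt g) (e₀ : E), apply_mem_archGardingSpace hτ _ e₀.2⟩) (diagGL2 u 1) *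
                ((mixedEmbedding.norm ((u : (mixedSpace K)ˣ) : mixedSpace K) : ℝ) : ℂ) ^ (s - 1 / 2) ∂μ =
            A' * Complex.exp (α' * s) *
              ((∏ j, Complex.Gammaℝ (s + a' j)) * ∏ j, Complex.Gammaℂ (s + b' j)))) :
    JacquetLanglands1970_standardLTheoryGL2 :=
  JacquetLanglands1970_standardLTheoryGL2_of_archHeckeTestVector_of_heckeEulerFactorisation' hA
    (fun hcpt μ _ Pl => heckeEulerFactorisationGL2 hcpt μ Pl)

/-- **Gelbart (1997), Prop. 4.1 at the σ-unramified places (Jacquet–Langlands (1970), Thm. 12.2 /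
Langlands, *Base change for GL(2)*, §3) from the archimedean test vector `(A∞)` ALONE**: the named fact
`frobSatakeCompatibleAt_of_isPiOfArtinRep_of_isUnramifiedAt` — if the cuspidal `π` of `GL₂(𝔸_F)`
corresponds to the `2`-dimensional Artin representation `σ` in the sense of `IsPiOfArtinRep`, then at every
finite place `v` where `σ` is unramified `π` is unramified with Satake parameter `{A(σ, v)}` — follows from
`(A∞)` (`frobSatakeCompatibleAt_of_isPiOfArtinRep_of_isUnramifiedAt_of_archHeckeTestVector_of_heckeEulerFactorisation'`
with `(E′)` = `heckeEulerFactorisationGL2`). [cite: Gelbart1997, Prop. 4.1]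
[cite: JacquetLanglands1970, Thm. 12.2, Thm. 11.1, Thm. 5.15, Thm. 6.4] -/
theorem frobSatakeCompatibleAt_of_isPiOfArtinRep_of_isUnramifiedAt_of_archHeckeTestVector
    (hA : ∀ (K : Type) [Field K] [NumberField K] (hcpt : isCompact_glFiniteIntegralLevel 2 K)
      (E : Type) [NormedAddCommGroup E] [InnerProductSpace ℂ E] [CompleteSpace E]
      (τ : ContRepresentation ℂ (AutomorphyDatum.gl 2 K hcpt).arch.carrier E) (hτ : τ.IsStronglyContinuous)
      (_ : τ.IsUnitary) (_ : τ.IsTopIrreducible)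
      (ℓ : archGardingSpace hcpt τ →ₗ[ℂ] ℂ) (_ : IsArchContWhittakerFunctional hcpt τ hτ ℓ) (_ : ℓ ≠ 0)
      [MeasurableSpace ((mixedSpace K)ˣ)] [BorelSpace ((mixedSpace K)ˣ)]
      (μ : Measure ((mixedSpace K)ˣ)) (_ : IsHaarMeasure μ),
      ∃ (e₀ : archGardingSpace hcpt τ)
        (_ : FiniteDimensional ℂ (Submodule.span ℂ (Set.range
          fun κ : (AutomorphyDatum.gl 2 K hcpt).arch.maximalCompact =>
            τ (toArch hcpt (κ : GL (Fin 2) (mixedSpace K))) (e₀ : E))))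
        (d₁ d₂ d₁' d₂' : ℕ) (a : Fin d₁ → ℂ) (b : Fin d₂ → ℂ) (a' : Fin d₁' → ℂ) (b' : Fin d₂' → ℂ)
        (A A' : ℂ) (_ : A ≠ 0) (_ : A' ≠ 0) (α α' : ℂ) (x₀ : ℝ),
        (∀ s : ℂ, x₀ < s.re →
          Integrable (fun u : (mixedSpace K)ˣ =>
            kirillovFn hτ ℓ e₀ u *
              ((mixedEmbedding.norm ((u : (mixedSpace K)ˣ) : mixedSpace K) : ℝ) : ℂ) ^ (s - 1 / 2)) μ ∧
          ∫ u : (mixedSpace K)ˣ, kirillovFn hτ ℓ e₀ u *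
              ((mixedEmbedding.norm ((u : (mixedSpace K)ˣ) : mixedSpace K) : ℝ) : ℂ) ^ (s - 1 / 2) ∂μ =
            A * Complex.exp (α * s) *
              ((∏ j, Complex.Gammaℝ (s + a j)) * ∏ j, Complex.Gammaℂ (s + b j))) ∧
        (∀ s : ℂ, x₀ < s.re →
          Integrable (fun u : (mixedSpace K)ˣ =>
            tildeFn (fun g : GL (Fin 2) (mixedSpace K) =>
                ℓ ⟨τ (toArch hcpt g) (e₀ : E), apply_mem_archGardingSpace hτ _ e₀.2⟩) (diagGL2 u 1) *
              ((mixedEmbedding.norm ((u : (mixedSpace K)ˣ) : mixedSpace K) : ℝ) : ℂ) ^ (s - 1 / 2)) μ ∧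
          ∫ u : (mixedSpace K)ˣ,
              tildeFn (fun g : GL (Fin 2) (mixedSpace K) =>
                  ℓ ⟨τ (toArch hcpt g) (e₀ : E), apply_mem_archGardingSpace hτ _ e₀.2⟩) (diagGL2 u 1) *
                ((mixedEmbedding.norm ((u : (mixedSpace K)ˣ) : mixedSpace K) : ℝ) : ℂ) ^ (s - 1 / 2) ∂μ =
            A' * Complex.exp (α' * s) *
              ((∏ j, Complex.Gammaℝ (s + a' j)) * ∏ j, Complex.Gammaℂ (s + b' j)))) :
    frobSatakeCompatibleAt_of_isPiOfArtinRep_of_isUnramifiedAt :=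
  frobSatakeCompatibleAt_of_isPiOfArtinRep_of_isUnramifiedAt_of_archHeckeTestVector_of_heckeEulerFactorisation' hA
    (fun hcpt μ _ Pl => heckeEulerFactorisationGL2 hcpt μ Pl)

/-- The same for the Galois-twisted Hecke theory `JacquetLanglands1970_twistedHeckeTheoryGL2` and the
`π`-unramified companion fact `frobSatakeCompatibleAt_of_isPiOfArtinRep` of Gelbart's Prop. 4.1 (both
from the standard `L`-theory, `TwistedHeckeTheoryGL2OfStandardLTheoryGL2Proofs`).
[cite: JacquetLanglands1970, Thm. 11.1, Cor. 11.2, Thm. 5.15, Thm. 6.4] [cite: Gelbart1997, Prop. 4.1] -/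
theorem JacquetLanglands1970_twistedHeckeTheoryGL2_and_frobSatakeCompatibleAt_of_archHeckeTestVector
    (hA : ∀ (K : Type) [Field K] [NumberField K] (hcpt : isCompact_glFiniteIntegralLevel 2 K)
      (E : Type) [NormedAddCommGroup E] [InnerProductSpace ℂ E] [CompleteSpace E]
      (τ : ContRepresentation ℂ (AutomorphyDatum.gl 2 K hcpt).arch.carrier E) (hτ : τ.IsStronglyContinuous)
      (_ : τ.IsUnitary) (_ : τ.IsTopIrreducible)
      (ℓ : archGardingSpace hcpt τ →ₗ[ℂ] ℂ) (_ : IsArchContWhittakerFunctional hcpt τ hτ ℓ) (_ : ℓ ≠ 0)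
      [MeasurableSpace ((mixedSpace K)ˣ)] [BorelSpace ((mixedSpace K)ˣ)]
      (μ : Measure ((mixedSpace K)ˣ)) (_ : IsHaarMeasure μ),
      ∃ (e₀ : archGardingSpace hcpt τ)
        (_ : FiniteDimensional ℂ (Submodule.span ℂ (Set.range
          fun κ : (AutomorphyDatum.gl 2 K hcpt).arch.maximalCompact =>
            τ (toArch hcpt (κ : GL (Fin 2) (mixedSpace K))) (e₀ : E))))
        (d₁ d₂ d₁' d₂' : ℕ) (a : Fin d₁ → ℂ) (b : Fin d₂ → ℂ) (a' : Fin d₁' → ℂ) (b' : Fin d₂' → ℂ)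
        (A A' : ℂ) (_ : A ≠ 0) (_ : A' ≠ 0) (α α' : ℂ) (x₀ : ℝ),
        (∀ s : ℂ, x₀ < s.re →
          Integrable (fun u : (mixedSpace K)ˣ =>
            kirillovFn hτ ℓ e₀ u *
              ((mixedEmbedding.norm ((u : (mixedSpace K)ˣ) : mixedSpace K) : ℝ) : ℂ) ^ (s - 1 / 2)) μ ∧
          ∫ u : (mixedSpace K)ˣ, kirillovFn hτ ℓ e₀ u *
              ((mixedEmbedding.norm ((u : (mixedSpace K)ˣ) : mixedSpace K) : ℝ) : ℂ) ^ (s - 1 / 2) ∂μ =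
            A * Complex.exp (α * s) *
              ((∏ j, Complex.Gammaℝ (s + a j)) * ∏ j, Complex.Gammaℂ (s + b j))) ∧
        (∀ s : ℂ, x₀ < s.re →
          Integrable (fun u : (mixedSpace K)ˣ =>
            tildeFn (fun g : GL (Fin 2) (mixedSpace K) =>
                ℓ ⟨τ (toArch hcpt g) (e₀ : E), apply_mem_archGardingSpace hτ _ e₀.2⟩) (diagGL2 u 1) *
              ((mixedEmbedding.norm ((u : (mixedSpace K)ˣ) : mixedSpace K) : ℝ) : ℂ) ^ (s - 1 / 2)) μ ∧
          ∫ u : (mixedSpace K)ˣ,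
              tildeFn (fun g : GL (Fin 2) (mixedSpace K) =>
                  ℓ ⟨τ (toArch hcpt g) (e₀ : E), apply_mem_archGardingSpace hτ _ e₀.2⟩) (diagGL2 u 1) *
                ((mixedEmbedding.norm ((u : (mixedSpace K)ˣ) : mixedSpace K) : ℝ) : ℂ) ^ (s - 1 / 2) ∂μ =
            A' * Complex.exp (α' * s) *
              ((∏ j, Complex.Gammaℝ (s + a' j)) * ∏ j, Complex.Gammaℂ (s + b' j)))) :
    JacquetLanglands1970_twistedHeckeTheoryGL2 ∧ frobSatakeCompatibleAt_of_isPiOfArtinRep :=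
  ⟨JacquetLanglands1970_twistedHeckeTheoryGL2_of_JacquetLanglands1970_standardLTheoryGL2
      (JacquetLanglands1970_standardLTheoryGL2_of_archHeckeTestVector hA),
    frobSatakeCompatibleAt_of_isPiOfArtinRep_of_JacquetLanglands1970_standardLTheoryGL2
      (JacquetLanglands1970_standardLTheoryGL2_of_archHeckeTestVector hA)⟩

end Corollaries

/-! ### 4. The same from the archimedean test vector for the archimedean components of the CUSPIDAL
representations only -/

section Cuspidal

/-- **The analytic package `(IR)` for clean `A_G`-invariant cuspidal data of `GL₂(𝔸_F)` from the
archimedean test vector at the archimedean components of cuspidal representations** (a formally WEAKER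
input than `(A∞)`: the two-sided test vector of Jacquet–Langlands (1970), Thm. 5.15 (ii)(iii) / Thm. 6.4 is
only required for the irreducible unitary `τ` which OCCUR as archimedean components of a cuspidal
`Π ≤ L²_cusp(GL₂)` — `∃ T ∈ archIntertwiners hcpt τ Π, T ≠ 0` — which is all the printed proof of Thm. 11.1
uses on p. 173). Same proof as `integralRepresentation_clean_of_archHeckeTestVector_of_heckeEulerFactorisation'`,
with `(E′)` supplied by `heckeEulerFactorisationGL2'`.
[cite: JacquetLanglands1970, Thm. 5.15, Thm. 6.4, (11.1.2), Lemma 11.1.3, proof of Thm. 11.1 (pp. 171–173)] -/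
theorem integralRepresentation_clean_of_archHeckeTestVectorCuspidal
    (hA : ∀ (K : Type) [Field K] [NumberField K] (hcpt : isCompact_glFiniteIntegralLevel 2 K)
      (μ : Measure (AdelicGroupData.gl 2 K).automorphicQuotient) [(AdelicGroupData.gl 2 K).IsAutomorphicMeasure μ]
      (Pl : CuspidalAutomorphicRepGL 2 K μ)
      (E : Type) [NormedAddCommGroup E] [InnerProductSpace ℂ E] [CompleteSpace E]
      (τ : ContRepresentation ℂ (AutomorphyDatum.gl 2 K hcpt).arch.carrier E) (hτ : τ.IsStronglyContinuous)
      (_ : τ.IsUnitary) (_ : τ.IsTopIrreducible) (_ : ∃ T ∈ archIntertwiners hcpt τ Pl.1, T ≠ 0)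
      (ℓ : archGardingSpace hcpt τ →ₗ[ℂ] ℂ) (_ : IsArchContWhittakerFunctional hcpt τ hτ ℓ) (_ : ℓ ≠ 0)
      [MeasurableSpace ((mixedSpace K)ˣ)] [BorelSpace ((mixedSpace K)ˣ)]
      (μ' : Measure ((mixedSpace K)ˣ)) (_ : IsHaarMeasure μ'),
      ∃ (e₀ : archGardingSpace hcpt τ)
        (_ : FiniteDimensional ℂ (Submodule.span ℂ (Set.range
          fun κ : (AutomorphyDatum.gl 2 K hcpt).arch.maximalCompact =>
            τ (toArch hcpt (κ : GL (Fin 2) (mixedSpace K))) (e₀ : E))))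
        (d₁ d₂ d₁' d₂' : ℕ) (a : Fin d₁ → ℂ) (b : Fin d₂ → ℂ) (a' : Fin d₁' → ℂ) (b' : Fin d₂' → ℂ)
        (A A' : ℂ) (_ : A ≠ 0) (_ : A' ≠ 0) (α α' : ℂ) (x₀ : ℝ),
        (∀ s : ℂ, x₀ < s.re →
          Integrable (fun u : (mixedSpace K)ˣ =>
            kirillovFn hτ ℓ e₀ u *
              ((mixedEmbedding.norm ((u : (mixedSpace K)ˣ) : mixedSpace K) : ℝ) : ℂ) ^ (s - 1 / 2)) μ' ∧
          ∫ u : (mixedSpace K)ˣ, kirillovFn hτ ℓ e₀ u *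
              ((mixedEmbedding.norm ((u : (mixedSpace K)ˣ) : mixedSpace K) : ℝ) : ℂ) ^ (s - 1 / 2) ∂μ' =
            A * Complex.exp (α * s) *
              ((∏ j, Complex.Gammaℝ (s + a j)) * ∏ j, Complex.Gammaℂ (s + b j))) ∧
        (∀ s : ℂ, x₀ < s.re →
          Integrable (fun u : (mixedSpace K)ˣ =>
            tildeFn (fun g : GL (Fin 2) (mixedSpace K) =>
                ℓ ⟨τ (toArch hcpt g) (e₀ : E), apply_mem_archGardingSpace hτ _ e₀.2⟩) (diagGL2 u 1) *
              ((mixedEmbedding.norm ((u : (mixedSpace K)ˣ) : mixedSpace K) : ℝ) : ℂ) ^ (s - 1 / 2)) μ' ∧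
          ∫ u : (mixedSpace K)ˣ,
              tildeFn (fun g : GL (Fin 2) (mixedSpace K) =>
                  ℓ ⟨τ (toArch hcpt g) (e₀ : E), apply_mem_archGardingSpace hτ _ e₀.2⟩) (diagGL2 u 1) *
                ((mixedEmbedding.norm ((u : (mixedSpace K)ˣ) : mixedSpace K) : ℝ) : ℂ) ^ (s - 1 / 2) ∂μ' =
            A' * Complex.exp (α' * s) *
              ((∏ j, Complex.Gammaℝ (s + a' j)) * ∏ j, Complex.Gammaℂ (s + b' j))))
    {F : Type} [Field F] [NumberField F] (hcpt : isCompact_glFiniteIntegralLevel 2 F)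
    (π : CuspidalAutomorphicRepData 2 F hcpt) (P P' : HeightOneSpectrum (𝓞 F) → ℂ[X])
    (hbot : π.1.W' = ⊥)
    (hAG : ∀ φ ∈ π.1.W, ∀ (t : ℝ≥0ˣ) (g : (AdelicGroupData.gl 2 F).Adelic),
      φ ((show (AdelicGroupData.gl 2 F).Adelic from posRealScalar 2 F t) * g) = φ g)
    (hP : ∀ (u : HeightOneSpectrum (𝓞 F)) (πu : SmoothIrrep (GL (Fin 2) (u.adicCompletion F))),
      π.1.HasLocalComponentAt u πu.ρ →
      ∀ (ψ : AddChar (u.adicCompletion F) Circle), ψ.IsContinuousNontrivial →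
      ∀ [MeasurableSpace (u.adicCompletion F)] [BorelSpace (u.adicCompletion F)]
        [MeasurableSpace (GL (Fin 1) (u.adicCompletion F) ⧸ upperUnitriangular (Fin 1) (u.adicCompletion F))]
        [BorelSpace (GL (Fin 1) (u.adicCompletion F) ⧸ upperUnitriangular (Fin 1) (u.adicCompletion F))]
        (ν : Measure (GL (Fin 1) (u.adicCompletion F) ⧸ upperUnitriangular (Fin 1) (u.adicCompletion F)))
        [SMulInvariantMeasure (GL (Fin 1) (u.adicCompletion F))
          (GL (Fin 1) (u.adicCompletion F) ⧸ upperUnitriangular (Fin 1) (u.adicCompletion F)) ν]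
        [IsFiniteMeasureOnCompacts ν] [ν.IsOpenPosMeasure],
        HasRSLFactor Nat.one_lt_two πu.ρ
          (Representation.trivial ℂ (GL (Fin 1) (u.adicCompletion F)) ℂ) ψ ν (P u))
    (hP' : ∀ (u : HeightOneSpectrum (𝓞 F)) (πu : SmoothIrrep (GL (Fin 2) (u.adicCompletion F))),
      π.transposeInv.1.HasLocalComponentAt u πu.ρ →
      ∀ (ψ : AddChar (u.adicCompletion F) Circle), ψ.IsContinuousNontrivial →
      ∀ [MeasurableSpace (u.adicCompletion F)] [BorelSpace (u.adicCompletion F)]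
        [MeasurableSpace (GL (Fin 1) (u.adicCompletion F) ⧸ upperUnitriangular (Fin 1) (u.adicCompletion F))]
        [BorelSpace (GL (Fin 1) (u.adicCompletion F) ⧸ upperUnitriangular (Fin 1) (u.adicCompletion F))]
        (ν : Measure (GL (Fin 1) (u.adicCompletion F) ⧸ upperUnitriangular (Fin 1) (u.adicCompletion F)))
        [SMulInvariantMeasure (GL (Fin 1) (u.adicCompletion F))
          (GL (Fin 1) (u.adicCompletion F) ⧸ upperUnitriangular (Fin 1) (u.adicCompletion F)) ν]
        [IsFiniteMeasureOnCompacts ν] [ν.IsOpenPosMeasure],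
        HasRSLFactor Nat.one_lt_two πu.ρ
          (Representation.trivial ℂ (GL (Fin 1) (u.adicCompletion F)) ℂ) ψ ν (P' u)) :
    ∃ (c₀ : ℝ) (Z Z' J J' Γ Γ' η : ℂ → ℂ),
      Differentiable ℂ Z ∧ Differentiable ℂ Z' ∧ Differentiable ℂ J ∧ Differentiable ℂ J' ∧
      Differentiable ℂ Γ ∧ Differentiable ℂ Γ' ∧
      (∃ Y : Set ℝ, Y.Finite ∧ ∀ s, Γ s = 0 → s.im ∈ Y) ∧
      (∃ Y : Set ℝ, Y.Finite ∧ ∀ s, Γ' s = 0 → s.im ∈ Y) ∧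
      (∀ s : ℂ, c₀ < s.re → J s ≠ 0 ∧ Z s * Γ s =
        J s * ∏' u : HeightOneSpectrum (𝓞 F), ((P u).eval ((u.residueCard : ℂ) ^ (-s)))⁻¹) ∧
      (∀ s : ℂ, c₀ < s.re → J' s ≠ 0 ∧ Z' s * Γ' s =
        J' s * ∏' u : HeightOneSpectrum (𝓞 F), ((P' u).eval ((u.residueCard : ℂ) ^ (-s)))⁻¹) ∧
      (∀ s, Z s = Z' (1 - s)) ∧
      Continuous η ∧ (∀ s, η s ≠ 0) ∧ (∀ s, J' (1 - s) = η s * J s) := by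
  classical
  /- `L²` realisations of `π` and of `π^τ` -/
  obtain ⟨μ, hμ⟩ : AdelicGroupData.exists_isAutomorphicMeasure_gl 2 F :=
    AdelicGroupData.exists_isAutomorphicMeasure_gl_holds 2 F
  haveI := hμ
  have hAG' : ∀ φ ∈ π.1.W, ∀ z ∈ (AdelicGroupData.gl 2 F).center', ∀ g, φ (z * g) = φ g := by
    intro φ hφ z hz g
    obtain ⟨t, rfl⟩ := MonoidHom.mem_range.1 hz
    exact hAG φ hφ t g
  obtain ⟨Pl, hass⟩ := AutomorphicRepsGL.exists_isAssociatedL2_holds hcpt μ π hAG'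
  obtain ⟨Pd, hassd⟩ := π.exists_isAssociatedL2_transposeInv μ hAG
  /- Borel structures at every place -/
  letI mA : MeasurableSpace ((mixedSpace F)ˣ) := borel _
  haveI : BorelSpace ((mixedSpace F)ˣ) := ⟨rfl⟩
  letI mF : ∀ u : HeightOneSpectrum (𝓞 F), MeasurableSpace (u.adicCompletion F) := fun u => borel _
  haveI : ∀ u : HeightOneSpectrum (𝓞 F), BorelSpace (u.adicCompletion F) := fun u => ⟨rfl⟩
  letI mQ : ∀ u : HeightOneSpectrum (𝓞 F),
      MeasurableSpace (GL (Fin 1) (u.adicCompletion F) ⧸ upperUnitriangular (Fin 1) (u.adicCompletion F)) :=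
    fun u => borel _
  haveI : ∀ u : HeightOneSpectrum (𝓞 F),
      BorelSpace (GL (Fin 1) (u.adicCompletion F) ⧸ upperUnitriangular (Fin 1) (u.adicCompletion F)) :=
    fun u => ⟨rfl⟩
  /- the Euler factorisation data of `Π` (`heckeEulerFactorisationGL2'`) -/
  obtain ⟨S₀, αf, hαf, E, _, _, _, τ, hτ, hτu, hτi, hexτ, ℓ, hℓ, hℓ0, μi, hμi, Vl, _, _, ρ, hρi, hρs, hρL, Λ,
    hΛ, hΛ0, ν, hν₁, hν₂, hν₃, hEul⟩ := heckeEulerFactorisationGL2' hcpt μ Pl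
  /- the archimedean test vector at the archimedean component `τ` of `Π` -/
  obtain ⟨e₀, he₀, d₁, d₂, d₁', d₂', a, b, a', b', A, A', hA0, hA'0, αe, αe', x₀, hI, hI'⟩ :=
    hA F hcpt μ Pl E τ hτ hτu hτi hexτ ℓ hℓ hℓ0 μi hμi
  /- local test vectors at the finite places -/
  have hψ : ∀ u : HeightOneSpectrum (𝓞 F), ((adeleAddChar F).adicComponent u).IsContinuousNontrivial :=
    fun u => (isGlobalAddChar_adeleAddChar F).isContinuousNontrivial_adicComponent
      (adicComponent_adeleAddChar_ne_one u)
  have hloc : ∀ u : HeightOneSpectrum (𝓞 F), ∃ (tu : Vl u) (eu : ℂ) (ku : ℤ) (xu : ℝ), eu ≠ 0 ∧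
      (∀ s : ℂ, xu < s.re →
        rsZeta Nat.one_lt_two (ν u) (whittakerModel (ρ u) (Λ u) tu) (fun _ => 1) s =
          ((P u).eval ((u.residueCard : ℂ) ^ (-s)))⁻¹) ∧
      (∀ s : ℂ, xu < s.re →
        rsZeta Nat.one_lt_two (ν u) (tildeFn (whittakerModel (ρ u) (Λ u) tu)) (fun _ => 1) s =
          eu * ((u.residueCard : ℂ) ^ (-s)) ^ ku * ((P' u).eval ((u.residueCard : ℂ) ^ (-s)))⁻¹) := by
    intro u
    haveI := hρi u
    haveI := hν₁ u
    haveI := hν₂ u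
    haveI := hν₃ u
    have h₁ := hasRSLFactor_of_isAssociatedL2_of_hasLocalComponentAt hbot hass hP u (hρi u) (hρs u)
      (hρL u) _ (hψ u) (ν u)
    have h₂ := hasRSLFactor_comp_glTransposeInv_of_isAssociatedL2_of_hasLocalComponentAt hbot hass hP' u
      (hρi u) (hρs u) (hρL u) _ (hψ u).inv (ν u)
    obtain ⟨tu, eu, ku, xu, heu, h₃, h₄⟩ :=
      exists_testVector_rsZeta_and_tildeFn (ρ u) (hρs u) (hψ u) (hΛ u) (hΛ0 u) (ν u) h₁ h₂
    refine ⟨tu, eu, ku, xu, heu, fun s hs => ?_, fun s hs => ?_⟩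
    · rw [h₃ s hs, residueFieldCard_adicCompletion_eq]
    · rw [h₄ s hs, residueFieldCard_adicCompletion_eq]
  choose t e k x he hZu hZ'u using hloc
  /- the global Hecke integrals of the pure tensor with these local components -/
  obtain ⟨Z, Z', c, hZd, hZ'd, hFE, hZE, hZ'E⟩ := hEul S₀ (Finset.Subset.refl _) t e₀ he₀ x₀
    (fun s hs => ⟨(hI s hs).1, (hI' s hs).1⟩)
  /- the finite-place `ε`-monomials -/
  obtain ⟨hEsd, hEs0⟩ := differentiable_prod_epsilonMonomial S₀ e k
  /- the abscissa -/
  set c₁ : ℝ := max (max c x₀) (max 1 (∑ u ∈ S₀, |x u|)) with hc₁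
  have hc_lt : ∀ {s : ℂ}, c₁ < s.re → c < s.re := fun hs =>
    lt_of_le_of_lt ((le_max_left _ _).trans (le_max_left _ _)) hs
  have hx₀_lt : ∀ {s : ℂ}, c₁ < s.re → x₀ < s.re := fun hs =>
    lt_of_le_of_lt ((le_max_right _ _).trans (le_max_left _ _)) hs
  have h1_lt : ∀ {s : ℂ}, c₁ < s.re → 1 < s.re := fun hs =>
    lt_of_le_of_lt ((le_max_left _ _).trans (le_max_right _ _)) hs
  have hxu_lt : ∀ {s : ℂ}, c₁ < s.re → ∀ u ∈ S₀, x u < s.re := fun hs u hu =>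
    lt_of_le_of_lt (((le_abs_self _).trans
      (Finset.single_le_sum (fun v _ => abs_nonneg (x v)) hu)).trans
        ((le_max_right _ _).trans (le_max_right _ _))) hs
  /- the `π`-side on the half-plane `re s > c₁` -/
  have hZ₁ : ∀ s : ℂ, c₁ < s.re →
      Z s = A * Complex.exp (αe * s) * ((∏ j, Complex.Gammaℝ (s + a j)) * ∏ j, Complex.Gammaℂ (s + b j)) *
        ∏' u : HeightOneSpectrum (𝓞 F), ((P u).eval ((u.residueCard : ℂ) ^ (-s)))⁻¹ := by
    intro s hs
    rw [hZE s (hc_lt hs), (hI s (hx₀_lt hs)).2,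
      tprod_localEulerPolynomial_eq_prod_mul_partialStandardL hass S₀ hαf hP s
        (multipliable_partialStandardL_holds Pl hαf (h1_lt hs)),
      Finset.prod_congr rfl fun u hu => hZu u s (hxu_lt hs u hu)]
    ring
  /- the `π^τ`-side on the half-plane `re s > c₁` -/
  have hZ'₁ : ∀ s : ℂ, c₁ < s.re →
      Z' s = A' * Complex.exp (αe' * s) * (∏ u ∈ S₀, e u * ((u.residueCard : ℂ) ^ (-s)) ^ (k u)) *
        ((∏ j, Complex.Gammaℝ (s + a' j)) * ∏ j, Complex.Gammaℂ (s + b' j)) *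
        ∏' u : HeightOneSpectrum (𝓞 F), ((P' u).eval ((u.residueCard : ℂ) ^ (-s)))⁻¹ := by
    intro s hs
    rw [hZ'E s (hc_lt hs), (hI' s (hx₀_lt hs)).2,
      tprod_localEulerPolynomial_transposeInv_eq_prod_mul_partialStandardL_dualFamily hass S₀ hαf hP' s
        (multipliable_partialEuler_dualFamily hass hassd hαf (h1_lt hs)),
      Finset.prod_congr rfl fun u hu => hZ'u u s (hxu_lt hs u hu), Finset.prod_mul_distrib]
    ring
  /- the Gamma bookkeeping -/
  obtain ⟨c₀, J, J', Γ, Γ', η, hJ, hJ', hΓ, hΓ', hY, hY', hZΓ, hZ'Γ, hη, hη0, hηJ⟩ :=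
    integralRepresentation_of_eulerFactorisations
      (L := fun s => ∏' u : HeightOneSpectrum (𝓞 F), ((P u).eval ((u.residueCard : ℂ) ^ (-s)))⁻¹)
      (L' := fun s => ∏' u : HeightOneSpectrum (𝓞 F), ((P' u).eval ((u.residueCard : ℂ) ^ (-s)))⁻¹)
      a b a' b' hA0 hA'0 hEsd (hEs0 he) hZ₁ hZ'₁
  exact ⟨c₀, Z, Z', J, J', Γ, Γ', η, hZd, hZ'd, hJ, hJ', hΓ, hΓ', hY, hY', hZΓ, hZ'Γ, hFE, hη, hη0, hηJ⟩

/-- **Jacquet–Langlands (1970), Thm. 11.1 / Cor. 11.2 (the named fact `JacquetLanglands1970_standardLTheoryGL2`)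
from the archimedean test vector at the archimedean components of cuspidal representations.**
[cite: JacquetLanglands1970, Thm. 11.1, Cor. 11.2, Thm. 5.15, Thm. 6.4] -/
theorem JacquetLanglands1970_standardLTheoryGL2_of_archHeckeTestVectorCuspidal
    (hA : ∀ (K : Type) [Field K] [NumberField K] (hcpt : isCompact_glFiniteIntegralLevel 2 K)
      (μ : Measure (AdelicGroupData.gl 2 K).automorphicQuotient) [(AdelicGroupData.gl 2 K).IsAutomorphicMeasure μ]
      (Pl : CuspidalAutomorphicRepGL 2 K μ)
      (E : Type) [NormedAddCommGroup E] [InnerProductSpace ℂ E] [CompleteSpace E]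
      (τ : ContRepresentation ℂ (AutomorphyDatum.gl 2 K hcpt).arch.carrier E) (hτ : τ.IsStronglyContinuous)
      (_ : τ.IsUnitary) (_ : τ.IsTopIrreducible) (_ : ∃ T ∈ archIntertwiners hcpt τ Pl.1, T ≠ 0)
      (ℓ : archGardingSpace hcpt τ →ₗ[ℂ] ℂ) (_ : IsArchContWhittakerFunctional hcpt τ hτ ℓ) (_ : ℓ ≠ 0)
      [MeasurableSpace ((mixedSpace K)ˣ)] [BorelSpace ((mixedSpace K)ˣ)]
      (μ' : Measure ((mixedSpace K)ˣ)) (_ : IsHaarMeasure μ'),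
      ∃ (e₀ : archGardingSpace hcpt τ)
        (_ : FiniteDimensional ℂ (Submodule.span ℂ (Set.range
          fun κ : (AutomorphyDatum.gl 2 K hcpt).arch.maximalCompact =>
            τ (toArch hcpt (κ : GL (Fin 2) (mixedSpace K))) (e₀ : E))))
        (d₁ d₂ d₁' d₂' : ℕ) (a : Fin d₁ → ℂ) (b : Fin d₂ → ℂ) (a' : Fin d₁' → ℂ) (b' : Fin d₂' → ℂ)
        (A A' : ℂ) (_ : A ≠ 0) (_ : A' ≠ 0) (α α' : ℂ) (x₀ : ℝ),
        (∀ s : ℂ, x₀ < s.re →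
          Integrable (fun u : (mixedSpace K)ˣ =>
            kirillovFn hτ ℓ e₀ u *
              ((mixedEmbedding.norm ((u : (mixedSpace K)ˣ) : mixedSpace K) : ℝ) : ℂ) ^ (s - 1 / 2)) μ' ∧
          ∫ u : (mixedSpace K)ˣ, kirillovFn hτ ℓ e₀ u *
              ((mixedEmbedding.norm ((u : (mixedSpace K)ˣ) : mixedSpace K) : ℝ) : ℂ) ^ (s - 1 / 2) ∂μ' =
            A * Complex.exp (α * s) *
              ((∏ j, Complex.Gammaℝ (s + a j)) * ∏ j, Complex.Gammaℂ (s + b j))) ∧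
        (∀ s : ℂ, x₀ < s.re →
          Integrable (fun u : (mixedSpace K)ˣ =>
            tildeFn (fun g : GL (Fin 2) (mixedSpace K) =>
                ℓ ⟨τ (toArch hcpt g) (e₀ : E), apply_mem_archGardingSpace hτ _ e₀.2⟩) (diagGL2 u 1) *
              ((mixedEmbedding.norm ((u : (mixedSpace K)ˣ) : mixedSpace K) : ℝ) : ℂ) ^ (s - 1 / 2)) μ' ∧
          ∫ u : (mixedSpace K)ˣ,
              tildeFn (fun g : GL (Fin 2) (mixedSpace K) =>
                  ℓ ⟨τ (toArch hcpt g) (e₀ : E), apply_mem_archGardingSpace hτ _ e₀.2⟩) (diagGL2 u 1) *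
                ((mixedEmbedding.norm ((u : (mixedSpace K)ˣ) : mixedSpace K) : ℝ) : ℂ) ^ (s - 1 / 2) ∂μ' =
            A' * Complex.exp (α' * s) *
              ((∏ j, Complex.Gammaℝ (s + a' j)) * ∏ j, Complex.Gammaℂ (s + b' j)))) :
    JacquetLanglands1970_standardLTheoryGL2 :=
  JacquetLanglands1970_standardLTheoryGL2_of_integralRepresentation_clean
    fun hcpt π P P' hbot hAG hP hP' =>
      integralRepresentation_clean_of_archHeckeTestVectorCuspidal hA hcpt π P P' hbot hAG hP hP'

/-- **Gelbart (1997), Prop. 4.1 at the σ-unramified places (the named fact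
`frobSatakeCompatibleAt_of_isPiOfArtinRep_of_isUnramifiedAt`) from the archimedean test vector at the
archimedean components of cuspidal representations.** [cite: Gelbart1997, Prop. 4.1]
[cite: JacquetLanglands1970, Thm. 12.2, Thm. 11.1, Thm. 5.15, Thm. 6.4] -/
theorem frobSatakeCompatibleAt_of_isPiOfArtinRep_of_isUnramifiedAt_of_archHeckeTestVectorCuspidal
    (hA : ∀ (K : Type) [Field K] [NumberField K] (hcpt : isCompact_glFiniteIntegralLevel 2 K)
      (μ : Measure (AdelicGroupData.gl 2 K).automorphicQuotient) [(AdelicGroupData.gl 2 K).IsAutomorphicMeasure μ]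
      (Pl : CuspidalAutomorphicRepGL 2 K μ)
      (E : Type) [NormedAddCommGroup E] [InnerProductSpace ℂ E] [CompleteSpace E]
      (τ : ContRepresentation ℂ (AutomorphyDatum.gl 2 K hcpt).arch.carrier E) (hτ : τ.IsStronglyContinuous)
      (_ : τ.IsUnitary) (_ : τ.IsTopIrreducible) (_ : ∃ T ∈ archIntertwiners hcpt τ Pl.1, T ≠ 0)
      (ℓ : archGardingSpace hcpt τ →ₗ[ℂ] ℂ) (_ : IsArchContWhittakerFunctional hcpt τ hτ ℓ) (_ : ℓ ≠ 0)
      [MeasurableSpace ((mixedSpace K)ˣ)] [BorelSpace ((mixedSpace K)ˣ)]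
      (μ' : Measure ((mixedSpace K)ˣ)) (_ : IsHaarMeasure μ'),
      ∃ (e₀ : archGardingSpace hcpt τ)
        (_ : FiniteDimensional ℂ (Submodule.span ℂ (Set.range
          fun κ : (AutomorphyDatum.gl 2 K hcpt).arch.maximalCompact =>
            τ (toArch hcpt (κ : GL (Fin 2) (mixedSpace K))) (e₀ : E))))
        (d₁ d₂ d₁' d₂' : ℕ) (a : Fin d₁ → ℂ) (b : Fin d₂ → ℂ) (a' : Fin d₁' → ℂ) (b' : Fin d₂' → ℂ)
        (A A' : ℂ) (_ : A ≠ 0) (_ : A' ≠ 0) (α α' : ℂ) (x₀ : ℝ),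
        (∀ s : ℂ, x₀ < s.re →
          Integrable (fun u : (mixedSpace K)ˣ =>
            kirillovFn hτ ℓ e₀ u *
              ((mixedEmbedding.norm ((u : (mixedSpace K)ˣ) : mixedSpace K) : ℝ) : ℂ) ^ (s - 1 / 2)) μ' ∧
          ∫ u : (mixedSpace K)ˣ, kirillovFn hτ ℓ e₀ u *
              ((mixedEmbedding.norm ((u : (mixedSpace K)ˣ) : mixedSpace K) : ℝ) : ℂ) ^ (s - 1 / 2) ∂μ' =
            A * Complex.exp (α * s) *
              ((∏ j, Complex.Gammaℝ (s + a j)) * ∏ j, Complex.Gammaℂ (s + b j))) ∧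
        (∀ s : ℂ, x₀ < s.re →
          Integrable (fun u : (mixedSpace K)ˣ =>
            tildeFn (fun g : GL (Fin 2) (mixedSpace K) =>
                ℓ ⟨τ (toArch hcpt g) (e₀ : E), apply_mem_archGardingSpace hτ _ e₀.2⟩) (diagGL2 u 1) *
              ((mixedEmbedding.norm ((u : (mixedSpace K)ˣ) : mixedSpace K) : ℝ) : ℂ) ^ (s - 1 / 2)) μ' ∧
          ∫ u : (mixedSpace K)ˣ,
              tildeFn (fun g : GL (Fin 2) (mixedSpace K) =>
                  ℓ ⟨τ (toArch hcpt g) (e₀ : E), apply_mem_archGardingSpace hτ _ e₀.2⟩) (diagGL2 u 1) *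
                ((mixedEmbedding.norm ((u : (mixedSpace K)ˣ) : mixedSpace K) : ℝ) : ℂ) ^ (s - 1 / 2) ∂μ' =
            A' * Complex.exp (α' * s) *
              ((∏ j, Complex.Gammaℝ (s + a' j)) * ∏ j, Complex.Gammaℂ (s + b' j)))) :
    frobSatakeCompatibleAt_of_isPiOfArtinRep_of_isUnramifiedAt :=
  frobSatakeCompatibleAt_of_isPiOfArtinRep_of_isUnramifiedAt_of_JacquetLanglands1970_standardLTheoryGL2
    (JacquetLanglands1970_standardLTheoryGL2_of_archHeckeTestVectorCuspidal hA)

/-- The Galois-twisted Hecke theory `JacquetLanglands1970_twistedHeckeTheoryGL2` and the `π`-unramified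
companion `frobSatakeCompatibleAt_of_isPiOfArtinRep` from the same input. [cite: Gelbart1997, Prop. 4.1]
[cite: JacquetLanglands1970, Thm. 11.1, Cor. 11.2, Thm. 5.15, Thm. 6.4] -/
theorem JacquetLanglands1970_twistedHeckeTheoryGL2_and_frobSatakeCompatibleAt_of_archHeckeTestVectorCuspidal
    (hA : ∀ (K : Type) [Field K] [NumberField K] (hcpt : isCompact_glFiniteIntegralLevel 2 K)
      (μ : Measure (AdelicGroupData.gl 2 K).automorphicQuotient) [(AdelicGroupData.gl 2 K).IsAutomorphicMeasure μ]
      (Pl : CuspidalAutomorphicRepGL 2 K μ)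
      (E : Type) [NormedAddCommGroup E] [InnerProductSpace ℂ E] [CompleteSpace E]
      (τ : ContRepresentation ℂ (AutomorphyDatum.gl 2 K hcpt).arch.carrier E) (hτ : τ.IsStronglyContinuous)
      (_ : τ.IsUnitary) (_ : τ.IsTopIrreducible) (_ : ∃ T ∈ archIntertwiners hcpt τ Pl.1, T ≠ 0)
      (ℓ : archGardingSpace hcpt τ →ₗ[ℂ] ℂ) (_ : IsArchContWhittakerFunctional hcpt τ hτ ℓ) (_ : ℓ ≠ 0)
      [MeasurableSpace ((mixedSpace K)ˣ)] [BorelSpace ((mixedSpace K)ˣ)]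
      (μ' : Measure ((mixedSpace K)ˣ)) (_ : IsHaarMeasure μ'),
      ∃ (e₀ : archGardingSpace hcpt τ)
        (_ : FiniteDimensional ℂ (Submodule.span ℂ (Set.range
          fun κ : (AutomorphyDatum.gl 2 K hcpt).arch.maximalCompact =>
            τ (toArch hcpt (κ : GL (Fin 2) (mixedSpace K))) (e₀ : E))))
        (d₁ d₂ d₁' d₂' : ℕ) (a : Fin d₁ → ℂ) (b : Fin d₂ → ℂ) (a' : Fin d₁' → ℂ) (b' : Fin d₂' → ℂ)
        (A A' : ℂ) (_ : A ≠ 0) (_ : A' ≠ 0) (α α' : ℂ) (x₀ : ℝ),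
        (∀ s : ℂ, x₀ < s.re →
          Integrable (fun u : (mixedSpace K)ˣ =>
            kirillovFn hτ ℓ e₀ u *
              ((mixedEmbedding.norm ((u : (mixedSpace K)ˣ) : mixedSpace K) : ℝ) : ℂ) ^ (s - 1 / 2)) μ' ∧
          ∫ u : (mixedSpace K)ˣ, kirillovFn hτ ℓ e₀ u *
              ((mixedEmbedding.norm ((u : (mixedSpace K)ˣ) : mixedSpace K) : ℝ) : ℂ) ^ (s - 1 / 2) ∂μ' =
            A * Complex.exp (α * s) *
              ((∏ j, Complex.Gammaℝ (s + a j)) * ∏ j, Complex.Gammaℂ (s + b j))) ∧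
        (∀ s : ℂ, x₀ < s.re →
          Integrable (fun u : (mixedSpace K)ˣ =>
            tildeFn (fun g : GL (Fin 2) (mixedSpace K) =>
                ℓ ⟨τ (toArch hcpt g) (e₀ : E), apply_mem_archGardingSpace hτ _ e₀.2⟩) (diagGL2 u 1) *
              ((mixedEmbedding.norm ((u : (mixedSpace K)ˣ) : mixedSpace K) : ℝ) : ℂ) ^ (s - 1 / 2)) μ' ∧
          ∫ u : (mixedSpace K)ˣ,
              tildeFn (fun g : GL (Fin 2) (mixedSpace K) =>
                  ℓ ⟨τ (toArch hcpt g) (e₀ : E), apply_mem_archGardingSpace hτ _ e₀.2⟩) (diagGL2 u 1) *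
                ((mixedEmbedding.norm ((u : (mixedSpace K)ˣ) : mixedSpace K) : ℝ) : ℂ) ^ (s - 1 / 2) ∂μ' =
            A' * Complex.exp (α' * s) *
              ((∏ j, Complex.Gammaℝ (s + a' j)) * ∏ j, Complex.Gammaℂ (s + b' j)))) :
    JacquetLanglands1970_twistedHeckeTheoryGL2 ∧ frobSatakeCompatibleAt_of_isPiOfArtinRep :=
  ⟨JacquetLanglands1970_twistedHeckeTheoryGL2_of_JacquetLanglands1970_standardLTheoryGL2
      (JacquetLanglands1970_standardLTheoryGL2_of_archHeckeTestVectorCuspidal hA),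
    frobSatakeCompatibleAt_of_isPiOfArtinRep_of_JacquetLanglands1970_standardLTheoryGL2
      (JacquetLanglands1970_standardLTheoryGL2_of_archHeckeTestVectorCuspidal hA)⟩

end Cuspidal

/-! ### 5. The minimal archimedean input: one `K_∞`-finite vector whose two archimedean Hecke integrals have
ENTIRE RECIPROCALS with finitely many zero ordinates -/

section Minimal

/-- **The analytic bookkeeping with an abstract archimedean factor.** If on `re s > c`
`Z = G · L` and `Z' = G' · E · L'` with `Γ G = 1`, `Γ' G' = 1` there for entire `Γ`, `Γ'` whose zeros lie on
finitely many horizontal lines and `E` entire zero-free, then the package `(IR)` holds with `J = 1`, `J' = E`,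
`η(s) = E(1 - s)` (the abstract form of `integralRepresentation_of_eulerFactorisations`, where
`G = A e^{αs} ∏ Γ_ℝ ∏ Γ_ℂ`). [folklore] -/
theorem integralRepresentation_of_reciprocalEntire {Z Z' L L' E G G' Γ Γ' : ℂ → ℂ}
    (hΓ : Differentiable ℂ Γ) (hΓ' : Differentiable ℂ Γ')
    (hY : ∃ Y : Set ℝ, Y.Finite ∧ ∀ s, Γ s = 0 → s.im ∈ Y)
    (hY' : ∃ Y : Set ℝ, Y.Finite ∧ ∀ s, Γ' s = 0 → s.im ∈ Y)
    (hE : Differentiable ℂ E) (hE0 : ∀ s, E s ≠ 0) {c : ℝ}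
    (hG : ∀ s : ℂ, c < s.re → Γ s * G s = 1) (hG' : ∀ s : ℂ, c < s.re → Γ' s * G' s = 1)
    (hZ : ∀ s : ℂ, c < s.re → Z s = G s * L s) (hZ' : ∀ s : ℂ, c < s.re → Z' s = G' s * E s * L' s) :
    ∃ (c₀ : ℝ) (J J' Γ₁ Γ₁' η : ℂ → ℂ),
      Differentiable ℂ J ∧ Differentiable ℂ J' ∧ Differentiable ℂ Γ₁ ∧ Differentiable ℂ Γ₁' ∧
      (∃ Y : Set ℝ, Y.Finite ∧ ∀ s, Γ₁ s = 0 → s.im ∈ Y) ∧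
      (∃ Y : Set ℝ, Y.Finite ∧ ∀ s, Γ₁' s = 0 → s.im ∈ Y) ∧
      (∀ s : ℂ, c₀ < s.re → J s ≠ 0 ∧ Z s * Γ₁ s = J s * L s) ∧
      (∀ s : ℂ, c₀ < s.re → J' s ≠ 0 ∧ Z' s * Γ₁' s = J' s * L' s) ∧
      Continuous η ∧ (∀ s, η s ≠ 0) ∧ (∀ s, J' (1 - s) = η s * J s) := by
  refine ⟨c, fun _ => 1, E, Γ, Γ', fun s => E (1 - s), differentiable_const _, hE, hΓ, hΓ', hY, hY',
    fun s hs => ⟨one_ne_zero, ?_⟩, fun s hs => ⟨hE0 s, ?_⟩,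
    hE.continuous.comp (continuous_const.sub continuous_id), fun s => hE0 _, fun s => (mul_one _).symm⟩
  · rw [hZ s hs, one_mul, mul_comm (G s), mul_assoc, mul_comm (G s), hG s hs, mul_one]
  · rw [hZ' s hs]
    calc G' s * E s * L' s * Γ' s = E s * L' s * (Γ' s * G' s) := by ring
      _ = E s * L' s := by rw [hG' s hs, mul_one]

/-- **The analytic package `(IR)` for clean `A_G`-invariant cuspidal data of `GL₂(𝔸_F)` from the MINIMAL
archimedean input**: for the archimedean component `τ` of every cuspidal `Π ≤ L²_cusp(GL₂)` (and the
transfer `ℓ_∞` of the global Whittaker functional, any Haar measure of `K_∞ˣ`), ONE `K_∞`-finite Gårding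
vector `e₀` whose two archimedean Hecke integrals `Ψ_∞(s; e₀) = ∫ W_{e₀}(diag(u,1)) N(u)^{s-1/2} d^×u` and
`Ψ̃_∞(s; e₀)` converge absolutely on a right half-plane and have there ENTIRE RECIPROCALS `Γ_∞`, `Γ̃_∞`
(`Γ_∞(s) Ψ_∞(s; e₀) = 1`) whose zeros lie on finitely many horizontal lines — e.g.
`Γ_∞ = 1 / (A e^{αs} ∏ Γ_ℝ(s + a_j) ∏ Γ_ℂ(s + b_j))` for Jacquet–Langlands' test vector of Thm. 5.15 / Thm. 6.4
(`differentiable_inv_archGammaProduct`, `inv_archGammaProduct_eq_zero_imp`, `StandardLTheoryGL2GammaPackage`).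
Same proof as `integralRepresentation_clean_of_archHeckeTestVectorCuspidal`, ending with
`integralRepresentation_of_reciprocalEntire` (`J = 1`, `J' = ∏_{u ∈ S} ε_u(s)`).
[cite: JacquetLanglands1970, Thm. 5.15, Thm. 6.4, proof of Thm. 11.1 (pp. 171–173)] -/
theorem integralRepresentation_clean_of_archHeckeTestVectorMin
    (hA : ∀ (K : Type) [Field K] [NumberField K] (hcpt : isCompact_glFiniteIntegralLevel 2 K)
      (μ : Measure (AdelicGroupData.gl 2 K).automorphicQuotient) [(AdelicGroupData.gl 2 K).IsAutomorphicMeasure μ]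
      (Pl : CuspidalAutomorphicRepGL 2 K μ)
      (E : Type) [NormedAddCommGroup E] [InnerProductSpace ℂ E] [CompleteSpace E]
      (τ : ContRepresentation ℂ (AutomorphyDatum.gl 2 K hcpt).arch.carrier E) (hτ : τ.IsStronglyContinuous)
      (_ : τ.IsUnitary) (_ : τ.IsTopIrreducible) (_ : ∃ T ∈ archIntertwiners hcpt τ Pl.1, T ≠ 0)
      (ℓ : archGardingSpace hcpt τ →ₗ[ℂ] ℂ) (_ : IsArchContWhittakerFunctional hcpt τ hτ ℓ) (_ : ℓ ≠ 0)
      [MeasurableSpace ((mixedSpace K)ˣ)] [BorelSpace ((mixedSpace K)ˣ)]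
      (μ' : Measure ((mixedSpace K)ˣ)) (_ : IsHaarMeasure μ'),
      ∃ (e₀ : archGardingSpace hcpt τ)
        (_ : FiniteDimensional ℂ (Submodule.span ℂ (Set.range
          fun κ : (AutomorphyDatum.gl 2 K hcpt).arch.maximalCompact =>
            τ (toArch hcpt (κ : GL (Fin 2) (mixedSpace K))) (e₀ : E))))
        (Γi Γi' : ℂ → ℂ) (_ : Differentiable ℂ Γi) (_ : Differentiable ℂ Γi')
        (_ : ∃ Y : Set ℝ, Y.Finite ∧ ∀ s, Γi s = 0 → s.im ∈ Y)
        (_ : ∃ Y : Set ℝ, Y.Finite ∧ ∀ s, Γi' s = 0 → s.im ∈ Y) (x₀ : ℝ),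
        ∀ s : ℂ, x₀ < s.re →
          (Integrable (fun u : (mixedSpace K)ˣ =>
              kirillovFn hτ ℓ e₀ u *
                ((mixedEmbedding.norm ((u : (mixedSpace K)ˣ) : mixedSpace K) : ℝ) : ℂ) ^ (s - 1 / 2)) μ' ∧
            Γi s * ∫ u : (mixedSpace K)ˣ, kirillovFn hτ ℓ e₀ u *
                ((mixedEmbedding.norm ((u : (mixedSpace K)ˣ) : mixedSpace K) : ℝ) : ℂ) ^ (s - 1 / 2) ∂μ' = 1) ∧
          (Integrable (fun u : (mixedSpace K)ˣ =>
              tildeFn (fun g : GL (Fin 2) (mixedSpace K) =>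
                  ℓ ⟨τ (toArch hcpt g) (e₀ : E), apply_mem_archGardingSpace hτ _ e₀.2⟩) (diagGL2 u 1) *
                ((mixedEmbedding.norm ((u : (mixedSpace K)ˣ) : mixedSpace K) : ℝ) : ℂ) ^ (s - 1 / 2)) μ' ∧
            Γi' s * ∫ u : (mixedSpace K)ˣ,
                tildeFn (fun g : GL (Fin 2) (mixedSpace K) =>
                    ℓ ⟨τ (toArch hcpt g) (e₀ : E), apply_mem_archGardingSpace hτ _ e₀.2⟩) (diagGL2 u 1) *
                  ((mixedEmbedding.norm ((u : (mixedSpace K)ˣ) : mixedSpace K) : ℝ) : ℂ) ^ (s - 1 / 2) ∂μ' = 1))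
    {F : Type} [Field F] [NumberField F] (hcpt : isCompact_glFiniteIntegralLevel 2 F)
    (π : CuspidalAutomorphicRepData 2 F hcpt) (P P' : HeightOneSpectrum (𝓞 F) → ℂ[X])
    (hbot : π.1.W' = ⊥)
    (hAG : ∀ φ ∈ π.1.W, ∀ (t : ℝ≥0ˣ) (g : (AdelicGroupData.gl 2 F).Adelic),
      φ ((show (AdelicGroupData.gl 2 F).Adelic from posRealScalar 2 F t) * g) = φ g)
    (hP : ∀ (u : HeightOneSpectrum (𝓞 F)) (πu : SmoothIrrep (GL (Fin 2) (u.adicCompletion F))),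
      π.1.HasLocalComponentAt u πu.ρ →
      ∀ (ψ : AddChar (u.adicCompletion F) Circle), ψ.IsContinuousNontrivial →
      ∀ [MeasurableSpace (u.adicCompletion F)] [BorelSpace (u.adicCompletion F)]
        [MeasurableSpace (GL (Fin 1) (u.adicCompletion F) ⧸ upperUnitriangular (Fin 1) (u.adicCompletion F))]
        [BorelSpace (GL (Fin 1) (u.adicCompletion F) ⧸ upperUnitriangular (Fin 1) (u.adicCompletion F))]
        (ν : Measure (GL (Fin 1) (u.adicCompletion F) ⧸ upperUnitriangular (Fin 1) (u.adicCompletion F)))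
        [SMulInvariantMeasure (GL (Fin 1) (u.adicCompletion F))
          (GL (Fin 1) (u.adicCompletion F) ⧸ upperUnitriangular (Fin 1) (u.adicCompletion F)) ν]
        [IsFiniteMeasureOnCompacts ν] [ν.IsOpenPosMeasure],
        HasRSLFactor Nat.one_lt_two πu.ρ
          (Representation.trivial ℂ (GL (Fin 1) (u.adicCompletion F)) ℂ) ψ ν (P u))
    (hP' : ∀ (u : HeightOneSpectrum (𝓞 F)) (πu : SmoothIrrep (GL (Fin 2) (u.adicCompletion F))),
      π.transposeInv.1.HasLocalComponentAt u πu.ρ →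
      ∀ (ψ : AddChar (u.adicCompletion F) Circle), ψ.IsContinuousNontrivial →
      ∀ [MeasurableSpace (u.adicCompletion F)] [BorelSpace (u.adicCompletion F)]
        [MeasurableSpace (GL (Fin 1) (u.adicCompletion F) ⧸ upperUnitriangular (Fin 1) (u.adicCompletion F))]
        [BorelSpace (GL (Fin 1) (u.adicCompletion F) ⧸ upperUnitriangular (Fin 1) (u.adicCompletion F))]
        (ν : Measure (GL (Fin 1) (u.adicCompletion F) ⧸ upperUnitriangular (Fin 1) (u.adicCompletion F)))
        [SMulInvariantMeasure (GL (Fin 1) (u.adicCompletion F))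
          (GL (Fin 1) (u.adicCompletion F) ⧸ upperUnitriangular (Fin 1) (u.adicCompletion F)) ν]
        [IsFiniteMeasureOnCompacts ν] [ν.IsOpenPosMeasure],
        HasRSLFactor Nat.one_lt_two πu.ρ
          (Representation.trivial ℂ (GL (Fin 1) (u.adicCompletion F)) ℂ) ψ ν (P' u)) :
    ∃ (c₀ : ℝ) (Z Z' J J' Γ Γ' η : ℂ → ℂ),
      Differentiable ℂ Z ∧ Differentiable ℂ Z' ∧ Differentiable ℂ J ∧ Differentiable ℂ J' ∧
      Differentiable ℂ Γ ∧ Differentiable ℂ Γ' ∧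
      (∃ Y : Set ℝ, Y.Finite ∧ ∀ s, Γ s = 0 → s.im ∈ Y) ∧
      (∃ Y : Set ℝ, Y.Finite ∧ ∀ s, Γ' s = 0 → s.im ∈ Y) ∧
      (∀ s : ℂ, c₀ < s.re → J s ≠ 0 ∧ Z s * Γ s =
        J s * ∏' u : HeightOneSpectrum (𝓞 F), ((P u).eval ((u.residueCard : ℂ) ^ (-s)))⁻¹) ∧
      (∀ s : ℂ, c₀ < s.re → J' s ≠ 0 ∧ Z' s * Γ' s =
        J' s * ∏' u : HeightOneSpectrum (𝓞 F), ((P' u).eval ((u.residueCard : ℂ) ^ (-s)))⁻¹) ∧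
      (∀ s, Z s = Z' (1 - s)) ∧
      Continuous η ∧ (∀ s, η s ≠ 0) ∧ (∀ s, J' (1 - s) = η s * J s) := by
  classical
  /- `L²` realisations of `π` and of `π^τ` -/
  obtain ⟨μ, hμ⟩ : AdelicGroupData.exists_isAutomorphicMeasure_gl 2 F :=
    AdelicGroupData.exists_isAutomorphicMeasure_gl_holds 2 F
  haveI := hμ
  have hAG' : ∀ φ ∈ π.1.W, ∀ z ∈ (AdelicGroupData.gl 2 F).center', ∀ g, φ (z * g) = φ g := by
    intro φ hφ z hz g
    obtain ⟨t, rfl⟩ := MonoidHom.mem_range.1 hz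
    exact hAG φ hφ t g
  obtain ⟨Pl, hass⟩ := AutomorphicRepsGL.exists_isAssociatedL2_holds hcpt μ π hAG'
  obtain ⟨Pd, hassd⟩ := π.exists_isAssociatedL2_transposeInv μ hAG
  /- Borel structures at every place -/
  letI mA : MeasurableSpace ((mixedSpace F)ˣ) := borel _
  haveI : BorelSpace ((mixedSpace F)ˣ) := ⟨rfl⟩
  letI mF : ∀ u : HeightOneSpectrum (𝓞 F), MeasurableSpace (u.adicCompletion F) := fun u => borel _
  haveI : ∀ u : HeightOneSpectrum (𝓞 F), BorelSpace (u.adicCompletion F) := fun u => ⟨rfl⟩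
  letI mQ : ∀ u : HeightOneSpectrum (𝓞 F),
      MeasurableSpace (GL (Fin 1) (u.adicCompletion F) ⧸ upperUnitriangular (Fin 1) (u.adicCompletion F)) :=
    fun u => borel _
  haveI : ∀ u : HeightOneSpectrum (𝓞 F),
      BorelSpace (GL (Fin 1) (u.adicCompletion F) ⧸ upperUnitriangular (Fin 1) (u.adicCompletion F)) :=
    fun u => ⟨rfl⟩
  /- the Euler factorisation data of `Π` (`heckeEulerFactorisationGL2'`) -/
  obtain ⟨S₀, αf, hαf, E, _, _, _, τ, hτ, hτu, hτi, hexτ, ℓ, hℓ, hℓ0, μi, hμi, Vl, _, _, ρ, hρi, hρs, hρL, Λ,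
    hΛ, hΛ0, ν, hν₁, hν₂, hν₃, hEul⟩ := heckeEulerFactorisationGL2' hcpt μ Pl
  /- the archimedean vector at the archimedean component `τ` of `Π` -/
  obtain ⟨e₀, he₀, Γi, Γi', hΓi, hΓi', hYi, hYi', x₀, hI⟩ :=
    hA F hcpt μ Pl E τ hτ hτu hτi hexτ ℓ hℓ hℓ0 μi hμi
  /- local test vectors at the finite places -/
  have hψ : ∀ u : HeightOneSpectrum (𝓞 F), ((adeleAddChar F).adicComponent u).IsContinuousNontrivial :=
    fun u => (isGlobalAddChar_adeleAddChar F).isContinuousNontrivial_adicComponent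
      (adicComponent_adeleAddChar_ne_one u)
  have hloc : ∀ u : HeightOneSpectrum (𝓞 F), ∃ (tu : Vl u) (eu : ℂ) (ku : ℤ) (xu : ℝ), eu ≠ 0 ∧
      (∀ s : ℂ, xu < s.re →
        rsZeta Nat.one_lt_two (ν u) (whittakerModel (ρ u) (Λ u) tu) (fun _ => 1) s =
          ((P u).eval ((u.residueCard : ℂ) ^ (-s)))⁻¹) ∧
      (∀ s : ℂ, xu < s.re →
        rsZeta Nat.one_lt_two (ν u) (tildeFn (whittakerModel (ρ u) (Λ u) tu)) (fun _ => 1) s =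
          eu * ((u.residueCard : ℂ) ^ (-s)) ^ ku * ((P' u).eval ((u.residueCard : ℂ) ^ (-s)))⁻¹) := by
    intro u
    haveI := hρi u
    haveI := hν₁ u
    haveI := hν₂ u
    haveI := hν₃ u
    have h₁ := hasRSLFactor_of_isAssociatedL2_of_hasLocalComponentAt hbot hass hP u (hρi u) (hρs u)
      (hρL u) _ (hψ u) (ν u)
    have h₂ := hasRSLFactor_comp_glTransposeInv_of_isAssociatedL2_of_hasLocalComponentAt hbot hass hP' u
      (hρi u) (hρs u) (hρL u) _ (hψ u).inv (ν u)
    obtain ⟨tu, eu, ku, xu, heu, h₃, h₄⟩ :=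
      exists_testVector_rsZeta_and_tildeFn (ρ u) (hρs u) (hψ u) (hΛ u) (hΛ0 u) (ν u) h₁ h₂
    refine ⟨tu, eu, ku, xu, heu, fun s hs => ?_, fun s hs => ?_⟩
    · rw [h₃ s hs, residueFieldCard_adicCompletion_eq]
    · rw [h₄ s hs, residueFieldCard_adicCompletion_eq]
  choose t e k x he hZu hZ'u using hloc
  /- the global Hecke integrals of the pure tensor with these local components -/
  obtain ⟨Z, Z', c, hZd, hZ'd, hFE, hZE, hZ'E⟩ := hEul S₀ (Finset.Subset.refl _) t e₀ he₀ x₀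
    (fun s hs => ⟨(hI s hs).1.1, (hI s hs).2.1⟩)
  /- the finite-place `ε`-monomials -/
  obtain ⟨hEsd, hEs0⟩ := differentiable_prod_epsilonMonomial S₀ e k
  /- the abscissa -/
  set c₁ : ℝ := max (max c x₀) (max 1 (∑ u ∈ S₀, |x u|)) with hc₁
  have hc_lt : ∀ {s : ℂ}, c₁ < s.re → c < s.re := fun hs =>
    lt_of_le_of_lt ((le_max_left _ _).trans (le_max_left _ _)) hs
  have hx₀_lt : ∀ {s : ℂ}, c₁ < s.re → x₀ < s.re := fun hs =>
    lt_of_le_of_lt ((le_max_right _ _).trans (le_max_left _ _)) hs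
  have h1_lt : ∀ {s : ℂ}, c₁ < s.re → 1 < s.re := fun hs =>
    lt_of_le_of_lt ((le_max_left _ _).trans (le_max_right _ _)) hs
  have hxu_lt : ∀ {s : ℂ}, c₁ < s.re → ∀ u ∈ S₀, x u < s.re := fun hs u hu =>
    lt_of_le_of_lt (((le_abs_self _).trans
      (Finset.single_le_sum (fun v _ => abs_nonneg (x v)) hu)).trans
        ((le_max_right _ _).trans (le_max_right _ _))) hs
  /- the `π`-side on the half-plane `re s > c₁` -/
  have hZ₁ : ∀ s : ℂ, c₁ < s.re →
      Z s = (∫ u : (mixedSpace F)ˣ, kirillovFn hτ ℓ e₀ u *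
          ((mixedEmbedding.norm ((u : (mixedSpace F)ˣ) : mixedSpace F) : ℝ) : ℂ) ^ (s - 1 / 2) ∂μi) *
        ∏' u : HeightOneSpectrum (𝓞 F), ((P u).eval ((u.residueCard : ℂ) ^ (-s)))⁻¹ := by
    intro s hs
    rw [hZE s (hc_lt hs),
      tprod_localEulerPolynomial_eq_prod_mul_partialStandardL hass S₀ hαf hP s
        (multipliable_partialStandardL_holds Pl hαf (h1_lt hs)),
      Finset.prod_congr rfl fun u hu => hZu u s (hxu_lt hs u hu)]
    ring
  /- the `π^τ`-side on the half-plane `re s > c₁` -/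
  have hZ'₁ : ∀ s : ℂ, c₁ < s.re →
      Z' s = (∫ u : (mixedSpace F)ˣ, tildeFn (fun g : GL (Fin 2) (mixedSpace F) =>
            ℓ ⟨τ (toArch hcpt g) (e₀ : E), apply_mem_archGardingSpace hτ _ e₀.2⟩) (diagGL2 u 1) *
          ((mixedEmbedding.norm ((u : (mixedSpace F)ˣ) : mixedSpace F) : ℝ) : ℂ) ^ (s - 1 / 2) ∂μi) *
        (∏ u ∈ S₀, e u * ((u.residueCard : ℂ) ^ (-s)) ^ (k u)) *
        ∏' u : HeightOneSpectrum (𝓞 F), ((P' u).eval ((u.residueCard : ℂ) ^ (-s)))⁻¹ := by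
    intro s hs
    rw [hZ'E s (hc_lt hs),
      tprod_localEulerPolynomial_transposeInv_eq_prod_mul_partialStandardL_dualFamily hass S₀ hαf hP' s
        (multipliable_partialEuler_dualFamily hass hassd hαf (h1_lt hs)),
      Finset.prod_congr rfl fun u hu => hZ'u u s (hxu_lt hs u hu), Finset.prod_mul_distrib]
    ring
  /- the bookkeeping -/
  obtain ⟨c₀, J, J', Γ, Γ', η, hJ, hJ', hΓ, hΓ', hY, hY', hZΓ, hZ'Γ, hη, hη0, hηJ⟩ :=
    integralRepresentation_of_reciprocalEntire
      (L := fun s => ∏' u : HeightOneSpectrum (𝓞 F), ((P u).eval ((u.residueCard : ℂ) ^ (-s)))⁻¹)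
      (L' := fun s => ∏' u : HeightOneSpectrum (𝓞 F), ((P' u).eval ((u.residueCard : ℂ) ^ (-s)))⁻¹)
      hΓi hΓi' hYi hYi' hEsd (hEs0 he) (fun s hs => (hI s (hx₀_lt hs)).1.2) (fun s hs => (hI s (hx₀_lt hs)).2.2)
      hZ₁ hZ'₁
  exact ⟨c₀, Z, Z', J, J', Γ, Γ', η, hZd, hZ'd, hJ, hJ', hΓ, hΓ', hY, hY', hZΓ, hZ'Γ, hFE, hη, hη0, hηJ⟩

/-- **Jacquet–Langlands (1970), Thm. 11.1 / Cor. 11.2 (the named fact `JacquetLanglands1970_standardLTheoryGL2`)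
from the minimal archimedean input.** [cite: JacquetLanglands1970, Thm. 11.1, Cor. 11.2, Thm. 5.15, Thm. 6.4] -/
theorem JacquetLanglands1970_standardLTheoryGL2_of_archHeckeTestVectorMin
    (hA : ∀ (K : Type) [Field K] [NumberField K] (hcpt : isCompact_glFiniteIntegralLevel 2 K)
      (μ : Measure (AdelicGroupData.gl 2 K).automorphicQuotient) [(AdelicGroupData.gl 2 K).IsAutomorphicMeasure μ]
      (Pl : CuspidalAutomorphicRepGL 2 K μ)
      (E : Type) [NormedAddCommGroup E] [InnerProductSpace ℂ E] [CompleteSpace E]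
      (τ : ContRepresentation ℂ (AutomorphyDatum.gl 2 K hcpt).arch.carrier E) (hτ : τ.IsStronglyContinuous)
      (_ : τ.IsUnitary) (_ : τ.IsTopIrreducible) (_ : ∃ T ∈ archIntertwiners hcpt τ Pl.1, T ≠ 0)
      (ℓ : archGardingSpace hcpt τ →ₗ[ℂ] ℂ) (_ : IsArchContWhittakerFunctional hcpt τ hτ ℓ) (_ : ℓ ≠ 0)
      [MeasurableSpace ((mixedSpace K)ˣ)] [BorelSpace ((mixedSpace K)ˣ)]
      (μ' : Measure ((mixedSpace K)ˣ)) (_ : IsHaarMeasure μ'),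
      ∃ (e₀ : archGardingSpace hcpt τ)
        (_ : FiniteDimensional ℂ (Submodule.span ℂ (Set.range
          fun κ : (AutomorphyDatum.gl 2 K hcpt).arch.maximalCompact =>
            τ (toArch hcpt (κ : GL (Fin 2) (mixedSpace K))) (e₀ : E))))
        (Γi Γi' : ℂ → ℂ) (_ : Differentiable ℂ Γi) (_ : Differentiable ℂ Γi')
        (_ : ∃ Y : Set ℝ, Y.Finite ∧ ∀ s, Γi s = 0 → s.im ∈ Y)
        (_ : ∃ Y : Set ℝ, Y.Finite ∧ ∀ s, Γi' s = 0 → s.im ∈ Y) (x₀ : ℝ),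
        ∀ s : ℂ, x₀ < s.re →
          (Integrable (fun u : (mixedSpace K)ˣ =>
              kirillovFn hτ ℓ e₀ u *
                ((mixedEmbedding.norm ((u : (mixedSpace K)ˣ) : mixedSpace K) : ℝ) : ℂ) ^ (s - 1 / 2)) μ' ∧
            Γi s * ∫ u : (mixedSpace K)ˣ, kirillovFn hτ ℓ e₀ u *
                ((mixedEmbedding.norm ((u : (mixedSpace K)ˣ) : mixedSpace K) : ℝ) : ℂ) ^ (s - 1 / 2) ∂μ' = 1) ∧
          (Integrable (fun u : (mixedSpace K)ˣ =>
              tildeFn (fun g : GL (Fin 2) (mixedSpace K) =>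
                  ℓ ⟨τ (toArch hcpt g) (e₀ : E), apply_mem_archGardingSpace hτ _ e₀.2⟩) (diagGL2 u 1) *
                ((mixedEmbedding.norm ((u : (mixedSpace K)ˣ) : mixedSpace K) : ℝ) : ℂ) ^ (s - 1 / 2)) μ' ∧
            Γi' s * ∫ u : (mixedSpace K)ˣ,
                tildeFn (fun g : GL (Fin 2) (mixedSpace K) =>
                    ℓ ⟨τ (toArch hcpt g) (e₀ : E), apply_mem_archGardingSpace hτ _ e₀.2⟩) (diagGL2 u 1) *
                  ((mixedEmbedding.norm ((u : (mixedSpace K)ˣ) : mixedSpace K) : ℝ) : ℂ) ^ (s - 1 / 2) ∂μ' = 1)) :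
    JacquetLanglands1970_standardLTheoryGL2 :=
  JacquetLanglands1970_standardLTheoryGL2_of_integralRepresentation_clean
    fun hcpt π P P' hbot hAG hP hP' =>
      integralRepresentation_clean_of_archHeckeTestVectorMin hA hcpt π P P' hbot hAG hP hP'

/-- **Gelbart (1997), Prop. 4.1 at the σ-unramified places (the named fact
`frobSatakeCompatibleAt_of_isPiOfArtinRep_of_isUnramifiedAt`) from the minimal archimedean input.**
[cite: Gelbart1997, Prop. 4.1] [cite: JacquetLanglands1970, Thm. 12.2, Thm. 11.1, Thm. 5.15, Thm. 6.4] -/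
theorem frobSatakeCompatibleAt_of_isPiOfArtinRep_of_isUnramifiedAt_of_archHeckeTestVectorMin
    (hA : ∀ (K : Type) [Field K] [NumberField K] (hcpt : isCompact_glFiniteIntegralLevel 2 K)
      (μ : Measure (AdelicGroupData.gl 2 K).automorphicQuotient) [(AdelicGroupData.gl 2 K).IsAutomorphicMeasure μ]
      (Pl : CuspidalAutomorphicRepGL 2 K μ)
      (E : Type) [NormedAddCommGroup E] [InnerProductSpace ℂ E] [CompleteSpace E]
      (τ : ContRepresentation ℂ (AutomorphyDatum.gl 2 K hcpt).arch.carrier E) (hτ : τ.IsStronglyContinuous)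
      (_ : τ.IsUnitary) (_ : τ.IsTopIrreducible) (_ : ∃ T ∈ archIntertwiners hcpt τ Pl.1, T ≠ 0)
      (ℓ : archGardingSpace hcpt τ →ₗ[ℂ] ℂ) (_ : IsArchContWhittakerFunctional hcpt τ hτ ℓ) (_ : ℓ ≠ 0)
      [MeasurableSpace ((mixedSpace K)ˣ)] [BorelSpace ((mixedSpace K)ˣ)]
      (μ' : Measure ((mixedSpace K)ˣ)) (_ : IsHaarMeasure μ'),
      ∃ (e₀ : archGardingSpace hcpt τ)
        (_ : FiniteDimensional ℂ (Submodule.span ℂ (Set.range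
          fun κ : (AutomorphyDatum.gl 2 K hcpt).arch.maximalCompact =>
            τ (toArch hcpt (κ : GL (Fin 2) (mixedSpace K))) (e₀ : E))))
        (Γi Γi' : ℂ → ℂ) (_ : Differentiable ℂ Γi) (_ : Differentiable ℂ Γi')
        (_ : ∃ Y : Set ℝ, Y.Finite ∧ ∀ s, Γi s = 0 → s.im ∈ Y)
        (_ : ∃ Y : Set ℝ, Y.Finite ∧ ∀ s, Γi' s = 0 → s.im ∈ Y) (x₀ : ℝ),
        ∀ s : ℂ, x₀ < s.re →
          (Integrable (fun u : (mixedSpace K)ˣ =>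
              kirillovFn hτ ℓ e₀ u *
                ((mixedEmbedding.norm ((u : (mixedSpace K)ˣ) : mixedSpace K) : ℝ) : ℂ) ^ (s - 1 / 2)) μ' ∧
            Γi s * ∫ u : (mixedSpace K)ˣ, kirillovFn hτ ℓ e₀ u *
                ((mixedEmbedding.norm ((u : (mixedSpace K)ˣ) : mixedSpace K) : ℝ) : ℂ) ^ (s - 1 / 2) ∂μ' = 1) ∧
          (Integrable (fun u : (mixedSpace K)ˣ =>
              tildeFn (fun g : GL (Fin 2) (mixedSpace K) =>
                  ℓ ⟨τ (toArch hcpt g) (e₀ : E), apply_mem_archGardingSpace hτ _ e₀.2⟩) (diagGL2 u 1) *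
                ((mixedEmbedding.norm ((u : (mixedSpace K)ˣ) : mixedSpace K) : ℝ) : ℂ) ^ (s - 1 / 2)) μ' ∧
            Γi' s * ∫ u : (mixedSpace K)ˣ,
                tildeFn (fun g : GL (Fin 2) (mixedSpace K) =>
                    ℓ ⟨τ (toArch hcpt g) (e₀ : E), apply_mem_archGardingSpace hτ _ e₀.2⟩) (diagGL2 u 1) *
                  ((mixedEmbedding.norm ((u : (mixedSpace K)ˣ) : mixedSpace K) : ℝ) : ℂ) ^ (s - 1 / 2) ∂μ' = 1)) :
    frobSatakeCompatibleAt_of_isPiOfArtinRep_of_isUnramifiedAt :=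
  frobSatakeCompatibleAt_of_isPiOfArtinRep_of_isUnramifiedAt_of_JacquetLanglands1970_standardLTheoryGL2
    (JacquetLanglands1970_standardLTheoryGL2_of_archHeckeTestVectorMin hA)

/-- The Galois-twisted Hecke theory `JacquetLanglands1970_twistedHeckeTheoryGL2` and the `π`-unramified
companion `frobSatakeCompatibleAt_of_isPiOfArtinRep` from the minimal archimedean input.
[cite: Gelbart1997, Prop. 4.1] [cite: JacquetLanglands1970, Thm. 11.1, Cor. 11.2, Thm. 5.15, Thm. 6.4] -/
theorem JacquetLanglands1970_twistedHeckeTheoryGL2_and_frobSatakeCompatibleAt_of_archHeckeTestVectorMin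
    (hA : ∀ (K : Type) [Field K] [NumberField K] (hcpt : isCompact_glFiniteIntegralLevel 2 K)
      (μ : Measure (AdelicGroupData.gl 2 K).automorphicQuotient) [(AdelicGroupData.gl 2 K).IsAutomorphicMeasure μ]
      (Pl : CuspidalAutomorphicRepGL 2 K μ)
      (E : Type) [NormedAddCommGroup E] [InnerProductSpace ℂ E] [CompleteSpace E]
      (τ : ContRepresentation ℂ (AutomorphyDatum.gl 2 K hcpt).arch.carrier E) (hτ : τ.IsStronglyContinuous)
      (_ : τ.IsUnitary) (_ : τ.IsTopIrreducible) (_ : ∃ T ∈ archIntertwiners hcpt τ Pl.1, T ≠ 0)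
      (ℓ : archGardingSpace hcpt τ →ₗ[ℂ] ℂ) (_ : IsArchContWhittakerFunctional hcpt τ hτ ℓ) (_ : ℓ ≠ 0)
      [MeasurableSpace ((mixedSpace K)ˣ)] [BorelSpace ((mixedSpace K)ˣ)]
      (μ' : Measure ((mixedSpace K)ˣ)) (_ : IsHaarMeasure μ'),
      ∃ (e₀ : archGardingSpace hcpt τ)
        (_ : FiniteDimensional ℂ (Submodule.span ℂ (Set.range
          fun κ : (AutomorphyDatum.gl 2 K hcpt).arch.maximalCompact =>
            τ (toArch hcpt (κ : GL (Fin 2) (mixedSpace K))) (e₀ : E))))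
        (Γi Γi' : ℂ → ℂ) (_ : Differentiable ℂ Γi) (_ : Differentiable ℂ Γi')
        (_ : ∃ Y : Set ℝ, Y.Finite ∧ ∀ s, Γi s = 0 → s.im ∈ Y)
        (_ : ∃ Y : Set ℝ, Y.Finite ∧ ∀ s, Γi' s = 0 → s.im ∈ Y) (x₀ : ℝ),
        ∀ s : ℂ, x₀ < s.re →
          (Integrable (fun u : (mixedSpace K)ˣ =>
              kirillovFn hτ ℓ e₀ u *
                ((mixedEmbedding.norm ((u : (mixedSpace K)ˣ) : mixedSpace K) : ℝ) : ℂ) ^ (s - 1 / 2)) μ' ∧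
            Γi s * ∫ u : (mixedSpace K)ˣ, kirillovFn hτ ℓ e₀ u *
                ((mixedEmbedding.norm ((u : (mixedSpace K)ˣ) : mixedSpace K) : ℝ) : ℂ) ^ (s - 1 / 2) ∂μ' = 1) ∧
          (Integrable (fun u : (mixedSpace K)ˣ =>
              tildeFn (fun g : GL (Fin 2) (mixedSpace K) =>
                  ℓ ⟨τ (toArch hcpt g) (e₀ : E), apply_mem_archGardingSpace hτ _ e₀.2⟩) (diagGL2 u 1) *
                ((mixedEmbedding.norm ((u : (mixedSpace K)ˣ) : mixedSpace K) : ℝ) : ℂ) ^ (s - 1 / 2)) μ' ∧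
            Γi' s * ∫ u : (mixedSpace K)ˣ,
                tildeFn (fun g : GL (Fin 2) (mixedSpace K) =>
                    ℓ ⟨τ (toArch hcpt g) (e₀ : E), apply_mem_archGardingSpace hτ _ e₀.2⟩) (diagGL2 u 1) *
                  ((mixedEmbedding.norm ((u : (mixedSpace K)ˣ) : mixedSpace K) : ℝ) : ℂ) ^ (s - 1 / 2) ∂μ' = 1)) :
    JacquetLanglands1970_twistedHeckeTheoryGL2 ∧ frobSatakeCompatibleAt_of_isPiOfArtinRep :=
  ⟨JacquetLanglands1970_twistedHeckeTheoryGL2_of_JacquetLanglands1970_standardLTheoryGL2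
      (JacquetLanglands1970_standardLTheoryGL2_of_archHeckeTestVectorMin hA),
    frobSatakeCompatibleAt_of_isPiOfArtinRep_of_JacquetLanglands1970_standardLTheoryGL2
      (JacquetLanglands1970_standardLTheoryGL2_of_archHeckeTestVectorMin hA)⟩

end Minimal

end Literature.NumberTheory.Automorphic
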